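import Mathlib.Analysis.SpecialFunctions.Trigonometric.DerivHyp
import Mathlib.Analysis.SpecialFunctions.Log.Basic
import Mathlib.Combinatorics.SimpleGraph.Paths
import Literature.Probability.LatticeModels.PlanarIsing
import Literature.Probability.LatticeModels.GKSInequalities
import Literature.Probability.LatticeModels.GriffithsMonotonicity
import HarnessLib
import Mathlib.Combinatorics.SimpleGraph.Trails
import Literature.Probability.LatticeModels.PlusStateFKG
import Literature.Probability.LatticeModels.ModifiedSimonInequality
import Literature.Probability.Percolation.Crossings

/-!
# Kramers–Wannier duality with boundary conditions (Benettin–Gallavotti–Jona-Lasinio–Stella)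

Topic `Probability/LatticeModels`, namespace `Literature.CritIsing`. The duality transformation of the
two-dimensional nearest-neighbour Ising model at zero field (Kramers–Wannier, Phys. Rev. 60
(1941) 252) in the form with boundary conditions printed in

* G. Benettin, G. Gallavotti, G. Jona-Lasinio, A. L. Stella, *On the Onsager–Yang value of the
  spontaneous magnetization*, Comm. Math. Phys. **30** (1973) 45–54 ("BGJS"), §2, eqs.
  (2.2)–(2.4), and Appendix, eqs. (A.5)–(A.10):

"closed boundary conditions are dual to open boundary conditions" (§2), the open (free) two-spin
correlation at `β` being the closed (plus) expectation, at the dual temperature `β*`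
(`e^{-2β*} = tanh β`, (2.2)), of the product of the *disorder variables*
`cosh 2β* − σ_{b*} sinh 2β*` over the dual bonds `b*` crossing a lattice path from `x` to `y`
((2.3), (A.10)), and symmetrically with open and closed exchanged ((2.4)). These identities are
the input of BGJS's eq. (3.10) (`⟨σσ⟩_a = ⟨σσ⟩_+` above `β_c`), vendored in `OnsagerYang.lean` as
the named fact `twoPointFree_eq_twoPointPlus_of_criticalBetaTwo_lt` and derived from the present
(discharged) facts in `OnsagerYangProofs.lean`.

## Contents

* `dualBeta β = −½ log tanh β` — the dual inverse temperature `β*` of (2.2) (`J = 1`), with its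
  elementary API: `exp_neg_two_mul_dualBeta` (`e^{-2β*} = tanh β`), `tanh_dualBeta`
  (`tanh β* = e^{-2β}`), `dualBeta_dualBeta` (involution), `sinh_two_mul_dualBeta`
  (`sinh 2β* = (sinh 2β)⁻¹`), `dualBeta_criticalBetaTwo` (the self-dual point is `β_c(2)`,
  `sinh 2β_c = 1`), `dualBeta_lt_criticalBetaTwo` ("for `β > β_c` we have `β* < β_c`", App. b)).
* `dualPair e` — the two dual sites (faces of `ℤ²`, labelled by their lower-left corner) whose
  dual bond `b*` crosses the lattice bond `e = b` (BGJS Fig. 2): by definition the endpoint set of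
  the tree's `Literature.StatMech.dualEdge e` (`Percolation/Crossings.lean`, same convention);
  `kwDisorder β' Γ` — the disorder observable `∏_{b ∈ Γ} (cosh 2β' − σ_{b*} sinh 2β')` of a list of
  bonds.
* Named facts (`def … : Prop`, cited): `kw_free_plus_finite` and `kw_plus_free_finite` — BGJS
  (A.10) for rectangles, both directions (open `N × M` rectangle ↔ closed `(N−1) × (M−1)`
  rectangle of faces; closed rectangle ↔ open `(N+1) × (M+1)` rectangle of faces);
  `kw_free_plus` and `kw_plus_free` — BGJS (2.3), (2.4) in the thermodynamic limit for the pair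
  correlation `⟨σ₀σ_x⟩` (the tree's `twoPointFree`/`twoPointPlus` and `plusExpect`/`freeExpect`).
* Proved (Part I): the disorder observable is a spin polynomial (`kwDisorder_isSpinPolynomial`),
  and infinite-volume free/plus expectations of spin polynomials are the corresponding
  combinations of correlations (`plusExpect_spinPolynomial`, `freeExpect_spinPolynomial`), whence
  `freeExpect_eq_plusExpect_of_corr_eq` (used for BGJS d) at `β*`).
* Proved (Part II): **all four named facts are discharged** — `kw_free_plus_finite_holds`,
  `kw_plus_free_finite_holds` (BGJS (A.10), by the high- and low-temperature expansions and the
  bijection between closed-boundary face configurations and closed multipolygons), and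
  `kw_free_plus_holds`, `kw_plus_free_holds` (BGJS (2.3)–(2.4), by the limit along boxes).

## Conventions (validated by brute force on `N, M ≤ 4`, see the session notes)

Sites of `ℤ²` are `x = (x 0, x 1)`; the face (plaquette) with lower-left corner `z` is labelled by
`z ∈ ℤ²` (the dual lattice `ℤ² + (½,½)` shifted back by `(½,½)`). The horizontal bond
`{(i,j),(i+1,j)}` is crossed by the dual bond between the faces `(i,j−1)` and `(i,j)`; the
vertical bond `{(i,j),(i,j+1)}` by the dual bond between the faces `(i−1,j)` and `(i,j)`. With
these conventions the open `[a,b]`-rectangle of sites is dual to the closed rectangle of faces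
`[a, b−(1,1)]`, and the closed `[a,b]`-rectangle of sites to the open rectangle of faces
`[a−(1,1), b]` (BGJS App. b): "`Λ*` … obtained from `Λ` by drawing a unit segment `b*`
perpendicular to each link `b` of `Λ` at its middle point; for `Λ*` we choose closed boundary
conditions", `L* = (N−1) × (M−1)` free dual spins).

## Tree and Mathlib status

The tree already has the **free high-temperature expansion for arbitrary graphs**
(`ModifiedSimonInequality.lean`: `Literature.Probability.LatticeModels.oddVerts`, `hteSum`, `isingWeight_free_zero_field_eq`,
`isingPartitionFunction_free_eq_hteSum`, `isingCorr_free_eq_hteSum_div`) and the **planar dual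
edge** `Literature.Probability.Percolation.dualEdge` (`Percolation/Crossings.lean`). Both are imported and used: the
free-correlation ratio `isingCorr_free_eq_ratio` and the partition function
`isingPartitionFunction_free_zero_eq` below are the tree's statements transported to the anchored
bonds `AEdge = ℤ² × Fin 2` of this file (bridges `edgesIn_eq_image_anch`, `oddSet_eq_oddVerts`,
`sum_bondSets_pow_eq_hteSum`), and `dualPair` is the endpoint set of `dualEdge`. What is new here
is the expansion with *bond-dependent activities* (`sum_spinProduct_mul_prod_eq`, needed for the
disorder insertion, BGJS (A.8)–(A.9)), the low-temperature polygon bijection for closed boundary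
conditions on rectangles, and the duality itself. Mathlib has no Ising model and no
Kramers–Wannier duality. Anchors: `Real.tanh_eq`,
`Real.exp_log`, `Real.log_exp`, `Real.sinh_eq`, `Real.cosh_add_sinh`, `Real.cosh_sub_sinh`,
`SimpleGraph.Walk.edges`, `SimpleGraph.Walk.IsPath`, `SimpleGraph.Walk.IsTrail.even_countP_edges_iff`,
`Finset.Icc` on `Fin 2 → ℤ`, `Sym2.lift`, `Finset.prod_add`, `Finset.sum_nbij'`, `Fintype.prod_sum`,
`Filter.limUnder`, `tendsto_of_tendsto_of_tendsto_of_le_of_le'`.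

## References

* H. A. Kramers, G. H. Wannier, Phys. Rev. 60 (1941) 252–262.
* G. Benettin, G. Gallavotti, G. Jona-Lasinio, A. L. Stella, Comm. Math. Phys. 30 (1973) 45–54.
* L. Onsager, Phys. Rev. 65 (1944) 117–149 (the self-dual point `sinh 2β_c = 1`).
-/

noncomputable section

open MeasureTheory Filter Topology Finset Literature.Probability.LatticeModels Literature.Probability.Percolation
open scoped symmDiff

namespace Literature.Probability.LatticeModels

/-! ### The dual temperature (BGJS (2.2)) -/

/-- The **dual inverse temperature** `β*` of the square-lattice Ising model, defined by
`e^{-2β*J} = tanh(βJ)` (BGJS eq. (2.2); here `J = 1`): `β* = −½ log tanh β`. Meaningful for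
`β > 0` (for `β ≤ 0`, `tanh β ≤ 0` and the value is Mathlib's junk `log`). [cite: BenettinGallavottiJonaLasinioStella1973, eq. (2.2)] -/
def dualBeta (β : ℝ) : ℝ := -(1 / 2) * Real.log (Real.tanh β)

/-- `tanh β = (e^{2β} − 1)/(e^{2β} + 1)`. [folklore] -/
theorem tanh_eq_exp_two_mul (β : ℝ) :
    Real.tanh β = (Real.exp (2 * β) - 1) / (Real.exp (2 * β) + 1) := by
  rw [Real.tanh_eq]
  have h1 : Real.exp (2 * β) = Real.exp β * Real.exp β := by rw [two_mul, Real.exp_add]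
  have h2 : Real.exp (-β) = (Real.exp β)⁻¹ := Real.exp_neg β
  have hpos : 0 < Real.exp β := Real.exp_pos β
  rw [h1, h2]
  field_simp

/-- `0 < tanh β < 1` for `β > 0`. [folklore] -/
theorem tanh_pos_of_pos {β : ℝ} (hβ : 0 < β) : 0 < Real.tanh β := by
  rw [Real.tanh_eq_sinh_div_cosh]
  exact div_pos (Real.sinh_pos_iff.2 hβ) (Real.cosh_pos β)

/-- **BGJS (2.2)**: `e^{-2β*} = tanh β` for `β > 0`. [cite: BenettinGallavottiJonaLasinioStella1973, eq. (2.2)] -/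
theorem exp_neg_two_mul_dualBeta {β : ℝ} (hβ : 0 < β) :
    Real.exp (-2 * dualBeta β) = Real.tanh β := by
  rw [dualBeta, show -2 * (-(1 / 2) * Real.log (Real.tanh β)) = Real.log (Real.tanh β) by ring,
    Real.exp_log (tanh_pos_of_pos hβ)]

/-- `e^{2β*} = (e^{2β} + 1)/(e^{2β} − 1)` for `β > 0`. [folklore] -/
theorem exp_two_mul_dualBeta {β : ℝ} (hβ : 0 < β) :
    Real.exp (2 * dualBeta β) = (Real.exp (2 * β) + 1) / (Real.exp (2 * β) - 1) := by
  have h := exp_neg_two_mul_dualBeta hβ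
  rw [tanh_eq_exp_two_mul] at h
  have hE : 1 < Real.exp (2 * β) := Real.one_lt_exp_iff.2 (by linarith)
  rw [show (2 : ℝ) * dualBeta β = -(-2 * dualBeta β) by ring, Real.exp_neg, h, inv_div]

/-- The dual temperature is positive: `β* > 0` for `β > 0` (`tanh β < 1`). [cite: BenettinGallavottiJonaLasinioStella1973, eq. (2.2)] -/
theorem dualBeta_pos {β : ℝ} (hβ : 0 < β) : 0 < dualBeta β := by
  rw [dualBeta]
  have h1 : Real.log (Real.tanh β) < 0 := Real.log_neg (tanh_pos_of_pos hβ) (Real.tanh_lt_one β)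
  linarith

/-- **The duality is symmetric**: `tanh β* = e^{-2β}` for `β > 0` (BGJS App. b): "equation (A.5)
defines uniquely a dual temperature `β*`"; `tanh K = e^{-2K*}` is symmetric in `K, K*`). [cite: BenettinGallavottiJonaLasinioStella1973, Appendix b), eq. (A.5)] -/
theorem tanh_dualBeta {β : ℝ} (hβ : 0 < β) : Real.tanh (dualBeta β) = Real.exp (-2 * β) := by
  rw [tanh_eq_exp_two_mul, exp_two_mul_dualBeta hβ]
  have hE : 1 < Real.exp (2 * β) := Real.one_lt_exp_iff.2 (by linarith)
  have hne : Real.exp (2 * β) - 1 ≠ 0 := by linarith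
  rw [show (-2 : ℝ) * β = -(2 * β) by ring, Real.exp_neg]
  field_simp
  ring

/-- **The duality is an involution**: `(β*)* = β` for `β > 0`. [cite: BenettinGallavottiJonaLasinioStella1973, Appendix b), eq. (A.5)] -/
theorem dualBeta_dualBeta {β : ℝ} (hβ : 0 < β) : dualBeta (dualBeta β) = β := by
  rw [dualBeta, tanh_dualBeta hβ, Real.log_exp]
  ring

/-- **`sinh 2β · sinh 2β* = 1`** for `β > 0` (the classical form of the Kramers–Wannier relation,
Onsager 1944; BGJS App. b) with `J₁ = J₂`). [cite: BenettinGallavottiJonaLasinioStella1973, Appendix b), eq. (A.5)] -/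
theorem sinh_two_mul_mul_sinh_two_mul_dualBeta {β : ℝ} (hβ : 0 < β) :
    Real.sinh (2 * β) * Real.sinh (2 * dualBeta β) = 1 := by
  have hE : 1 < Real.exp (2 * β) := Real.one_lt_exp_iff.2 (by linarith)
  have hne : Real.exp (2 * β) - 1 ≠ 0 := by linarith
  have hne' : Real.exp (2 * β) + 1 ≠ 0 := by linarith
  have h1 : Real.sinh (2 * β) = (Real.exp (2 * β) - (Real.exp (2 * β))⁻¹) / 2 := by
    rw [Real.sinh_eq, Real.exp_neg]
  have h2 : Real.sinh (2 * dualBeta β) =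
      ((Real.exp (2 * β) + 1) / (Real.exp (2 * β) - 1) -
        ((Real.exp (2 * β) + 1) / (Real.exp (2 * β) - 1))⁻¹) / 2 := by
    rw [Real.sinh_eq, Real.exp_neg, exp_two_mul_dualBeta hβ]
  rw [h1, h2]
  have hE0 : Real.exp (2 * β) ≠ 0 := (Real.exp_pos _).ne'
  field_simp
  ring

/-- `sinh 2β* = (sinh 2β)⁻¹` for `β > 0`. [cite: BenettinGallavottiJonaLasinioStella1973, Appendix b), eq. (A.5)] -/
theorem sinh_two_mul_dualBeta {β : ℝ} (hβ : 0 < β) :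
    Real.sinh (2 * dualBeta β) = (Real.sinh (2 * β))⁻¹ := by
  have h := sinh_two_mul_mul_sinh_two_mul_dualBeta hβ
  have hpos : 0 < Real.sinh (2 * β) := Real.sinh_pos_iff.2 (by linarith)
  field_simp
  linarith

/-- **The self-dual point is Onsager's `β_c`**: `(β_c(2))* = β_c(2)` (BGJS App. b): "the value `β_c`
for which `β* = β = β_c` is the Onsager critical temperature"; `sinh 2β_c(2) = 1`). [cite: BenettinGallavottiJonaLasinioStella1973, Appendix b)] -/
theorem dualBeta_criticalBetaTwo : dualBeta criticalBetaTwo = criticalBetaTwo := by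
  have h := sinh_two_mul_dualBeta criticalBetaTwo_pos
  rw [sinh_two_mul_criticalBetaTwo, inv_one, ← sinh_two_mul_criticalBetaTwo] at h
  have h2 := Real.sinh_injective h
  linarith

/-- The duality reverses the order of temperatures: `β ↦ β*` is strictly decreasing on `(0, ∞)`. [cite: BenettinGallavottiJonaLasinioStella1973, Appendix b)] -/
theorem dualBeta_strictAntiOn : StrictAntiOn dualBeta (Set.Ioi 0) := by
  intro a ha b hb hab
  have ha' : 0 < a := ha
  have hb' : 0 < b := hb
  -- compare `sinh 2a* = (sinh 2a)⁻¹ > (sinh 2b)⁻¹ = sinh 2b*`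
  have hsa : 0 < Real.sinh (2 * a) := Real.sinh_pos_iff.2 (by linarith)
  have hlt : (Real.sinh (2 * b))⁻¹ < (Real.sinh (2 * a))⁻¹ :=
    inv_strictAnti₀ hsa (Real.sinh_strictMono (by linarith : 2 * a < 2 * b))
  rw [← sinh_two_mul_dualBeta ha', ← sinh_two_mul_dualBeta hb'] at hlt
  have h2 := Real.sinh_strictMono.lt_iff_lt.1 hlt
  change dualBeta b < dualBeta a
  linarith

/-- **"For `β > β_c` we have `β* < β_c`"** (BGJS App. b)). [cite: BenettinGallavottiJonaLasinioStella1973, Appendix b)] -/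
theorem dualBeta_lt_criticalBetaTwo {β : ℝ} (hβ : criticalBetaTwo < β) :
    dualBeta β < criticalBetaTwo := by
  have h := dualBeta_strictAntiOn (Set.mem_Ioi.2 criticalBetaTwo_pos)
    (Set.mem_Ioi.2 (criticalBetaTwo_pos.trans hβ)) hβ
  rwa [dualBeta_criticalBetaTwo] at h

/-- "and vice versa": for `0 < β < β_c`, `β* > β_c` (BGJS App. b)). [cite: BenettinGallavottiJonaLasinioStella1973, Appendix b)] -/
theorem criticalBetaTwo_lt_dualBeta {β : ℝ} (hβ0 : 0 < β) (hβ : β < criticalBetaTwo) :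
    criticalBetaTwo < dualBeta β := by
  have h := dualBeta_strictAntiOn (Set.mem_Ioi.2 hβ0) (Set.mem_Ioi.2 criticalBetaTwo_pos) hβ
  rwa [dualBeta_criticalBetaTwo] at h

/-! ### Dual bonds and the disorder observable (BGJS §2, Fig. 2) -/

/-- The two **dual sites** (faces of `ℤ²`, labelled by their lower-left corners) at the ends of
the dual bond `b*` crossing the lattice bond `b = {u, v}` (BGJS §2 and Fig. 2: "`b*` perpendicular
to each link `b` at its middle point"; `σ_{b*}` is the product of the spins situated at the end
points of the link `b*`): the endpoint set of the tree's planar dual edge `Literature.StatMech.dualEdge b`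
(`Percolation/Crossings.lean`, Grimmett 1999 §11.2, identical convention: the horizontal bond
`{u, u+e₀}` is crossed by `{u−e₁, u}`, the vertical bond `{u, u+e₁}` by `{u−e₀, u}`; evaluated on
lattice bonds in `dualPair_toSym2`). Junk for non-bonds. [cite: BenettinGallavottiJonaLasinioStella1973, §2 and Fig. 2] -/
def dualPair (b : Sym2 (Site 2)) : Finset (Site 2) := (dualEdge b).toFinset

/-- `dualPair b` is the endpoint set of `dualEdge b`. [folklore] -/
theorem dualPair_eq_toFinset_dualEdge (b : Sym2 (Site 2)) : dualPair b = (dualEdge b).toFinset := rfl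

/-- The **disorder observable** of a list of lattice bonds `Γ = (b₁, …, bₙ)` at (dual) inverse
temperature `β'`: `∏_{b ∈ Γ} (cosh 2β' − σ_{b*} sinh 2β')`, where `σ_{b*}` is the product of the two
dual spins at the ends of the dual bond `b*` (BGJS eqs. (2.3)–(2.4), (A.10), with `J = 1`). [cite: BenettinGallavottiJonaLasinioStella1973, eqs. (2.3)–(2.4)] -/
def kwDisorder (β' : ℝ) (Γ : List (Sym2 (Site 2))) (σ : SpinConfig (Site 2)) : ℝ :=
  (Γ.map fun b => Real.cosh (2 * β') - spinProduct (dualPair b) σ * Real.sinh (2 * β')).prod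

/-- The disorder observable of the empty path is `1`. [folklore] -/
@[simp] theorem kwDisorder_nil (β' : ℝ) (σ : SpinConfig (Site 2)) : kwDisorder β' [] σ = 1 := by
  simp [kwDisorder]

/-- The disorder observable of `b :: Γ` factors. [folklore] -/
theorem kwDisorder_cons (β' : ℝ) (b : Sym2 (Site 2)) (Γ : List (Sym2 (Site 2)))
    (σ : SpinConfig (Site 2)) :
    kwDisorder β' (b :: Γ) σ =
      (Real.cosh (2 * β') - spinProduct (dualPair b) σ * Real.sinh (2 * β')) * kwDisorder β' Γ σ := by
  simp [kwDisorder]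

/-- The disorder observable is measurable (a polynomial in finitely many spins). [folklore] -/
@[fun_prop]
theorem measurable_kwDisorder (β' : ℝ) (Γ : List (Sym2 (Site 2))) :
    Measurable (kwDisorder β' Γ) := by
  induction Γ with
  | nil =>
    have h : kwDisorder β' [] = fun _ => (1 : ℝ) := funext (kwDisorder_nil β')
    rw [h]; exact measurable_const
  | cons b Γ ih =>
    have h : kwDisorder β' (b :: Γ) = fun σ =>
        (Real.cosh (2 * β') - spinProduct (dualPair b) σ * Real.sinh (2 * β')) * kwDisorder β' Γ σ :=
      funext (kwDisorder_cons β' b Γ)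
    rw [h]
    exact ((measurable_const.sub ((measurable_spinProduct _).mul measurable_const)).mul ih)

/-! ### Spin polynomials and their infinite-volume expectations -/

section SpinPolynomial

variable {d : ℕ}

/-- A **spin polynomial**: a finite linear combination `∑_{A ∈ S} c_A σ_A` of spin products
(every local observable is one, Friedli–Velenik 2017, Lemma 3.19). [cite: FriedliVelenik2017, Lemma 3.19] -/
def IsSpinPolynomial (f : SpinConfig (Site d) → ℝ) : Prop :=
  ∃ (S : Finset (Finset (Site d))) (c : Finset (Site d) → ℝ),
    f = fun σ => ∑ A ∈ S, c A * spinProduct A σ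

/-- Constants are spin polynomials (`c = c σ_∅`). [folklore] -/
theorem isSpinPolynomial_const (a : ℝ) : IsSpinPolynomial (fun _ : SpinConfig (Site d) => a) := by
  refine ⟨{∅}, (fun _ => a), ?_⟩
  funext σ
  simp [spinProduct]

/-- `a − σ_B · b` is a spin polynomial. [folklore] -/
theorem isSpinPolynomial_const_sub_mul (a b : ℝ) (B : Finset (Site d)) :
    IsSpinPolynomial (fun σ : SpinConfig (Site d) => a - spinProduct B σ * b) := by
  classical
  by_cases hB : B = ∅
  · subst hB
    refine ⟨{∅}, fun _ => a - b, funext fun σ => ?_⟩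
    simp [spinProduct]
  · refine ⟨{∅, B}, fun A => if A = ∅ then a else -b, funext fun σ => ?_⟩
    rw [Finset.sum_pair (Ne.symm hB)]
    simp [hB, spinProduct]
    ring

/-- Spin polynomials are closed under multiplication (`σ_A σ_B = σ_{A ∆ B}`). [folklore] -/
theorem IsSpinPolynomial.mul {f g : SpinConfig (Site d) → ℝ} (hf : IsSpinPolynomial f)
    (hg : IsSpinPolynomial g) : IsSpinPolynomial (fun σ => f σ * g σ) := by
  classical
  obtain ⟨S, c, rfl⟩ := hf
  obtain ⟨T, e, rfl⟩ := hg
  -- expand the product and regroup by the symmetric difference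
  let sd : Finset (Site d) × Finset (Site d) → Finset (Site d) := fun p => p.1 ∆ p.2
  refine ⟨(S ×ˢ T).image sd,
    (fun A => ∑ p ∈ (S ×ˢ T).filter (fun p => sd p = A), c p.1 * e p.2), funext fun σ => ?_⟩
  simp only
  rw [Finset.sum_mul_sum, ← Finset.sum_product']
  have hfib := Finset.sum_fiberwise_of_maps_to (s := S ×ˢ T) (t := (S ×ˢ T).image sd) (g := sd)
    (fun p hp => Finset.mem_image_of_mem sd hp) (fun p => c p.1 * e p.2 * spinProduct (sd p) σ)
  have hR : ∑ A ∈ (S ×ˢ T).image sd, (∑ p ∈ (S ×ˢ T).filter (fun p => sd p = A), c p.1 * e p.2) *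
      spinProduct A σ = ∑ A ∈ (S ×ˢ T).image sd,
        ∑ p ∈ (S ×ˢ T).filter (fun p => sd p = A), c p.1 * e p.2 * spinProduct (sd p) σ := by
    refine Finset.sum_congr rfl fun A _ => ?_
    rw [Finset.sum_mul]
    exact Finset.sum_congr rfl fun p hp => by rw [(Finset.mem_filter.1 hp).2]
  rw [hR, hfib]
  refine Finset.sum_congr rfl fun p _ => ?_
  have hsd : spinProduct (sd p) σ = spinProduct p.1 σ * spinProduct p.2 σ :=
    (spinProduct_mul_eq_spinProduct_symmDiff p.1 p.2 σ).symm
  rw [hsd]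
  ring

/-- **The disorder observable is a spin polynomial.** [folklore] -/
theorem kwDisorder_isSpinPolynomial (β' : ℝ) (Γ : List (Sym2 (Site 2))) :
    IsSpinPolynomial (kwDisorder β' Γ) := by
  induction Γ with
  | nil =>
    have h : kwDisorder β' [] = fun _ => (1 : ℝ) := funext (kwDisorder_nil β')
    rw [h]; exact isSpinPolynomial_const 1
  | cons b Γ ih =>
    have h : kwDisorder β' (b :: Γ) = fun σ =>
        (Real.cosh (2 * β') - spinProduct (dualPair b) σ * Real.sinh (2 * β')) * kwDisorder β' Γ σ :=
      funext (kwDisorder_cons β' b Γ)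
    rw [h]
    exact (isSpinPolynomial_const_sub_mul _ _ _).mul ih

/-- **The plus state on a spin polynomial** is the corresponding combination of plus
correlations: `⟨∑ c_A σ_A⟩⁺_{β,0} = ∑ c_A ⟨σ_A⟩⁺_{β,0}` for `β ≥ 0` (the box limits exist termwise,
Friedli–Velenik 2017, Thm. 3.17 / Exercise 3.16; `plusExpect` is their `limUnder`). [cite: FriedliVelenik2017, Thm. 3.17] -/
theorem plusExpect_spinPolynomial {β : ℝ} (hβ : 0 ≤ β) (S : Finset (Finset (Site d)))
    (c : Finset (Site d) → ℝ) :
    plusExpect d β 0 (fun σ => ∑ A ∈ S, c A * spinProduct A σ) = ∑ A ∈ S, c A * plusCorr d β 0 A := by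
  refine Tendsto.limUnder_eq ?_
  have h : ∀ L : ℕ, isingExpect (zdGraph d) (box d L) β 0 .plus (fun σ => ∑ A ∈ S, c A * spinProduct A σ) =
      ∑ A ∈ S, c A * isingCorr (zdGraph d) (box d L) β 0 .plus A := by
    intro L
    rw [isingExpect_finset_sum' (zdGraph d) (box d L) 0 .plus β S _
      fun A => (measurable_spinProduct A).const_mul (c A)]
    refine Finset.sum_congr rfl fun A _ => ?_
    rw [isingExpect_const_mul' (zdGraph d) (box d L) 0 .plus β _ (measurable_spinProduct A)]
    rfl
  simp only [h]
  exact tendsto_finsetSum _ fun A _ => (hasBoxLimit_isingCorr_plus_holds (d := d) hβ le_rfl A).const_mul _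

/-- **The free state on a spin polynomial**: `⟨∑ c_A σ_A⟩^∅_{β,0} = ∑ c_A ⟨σ_A⟩^∅_{β,0}` for `β ≥ 0`. [cite: FriedliVelenik2017, Exercise 3.16] -/
theorem freeExpect_spinPolynomial {β : ℝ} (hβ : 0 ≤ β) (S : Finset (Finset (Site d)))
    (c : Finset (Site d) → ℝ) :
    freeExpect d β 0 (fun σ => ∑ A ∈ S, c A * spinProduct A σ) = ∑ A ∈ S, c A * freeCorr d β 0 A := by
  refine Tendsto.limUnder_eq ?_
  have h : ∀ L : ℕ, isingExpect (zdGraph d) (box d L) β 0 .free (fun σ => ∑ A ∈ S, c A * spinProduct A σ) =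
      ∑ A ∈ S, c A * isingCorr (zdGraph d) (box d L) β 0 .free A := by
    intro L
    rw [isingExpect_finset_sum' (zdGraph d) (box d L) 0 .free β S _
      fun A => (measurable_spinProduct A).const_mul (c A)]
    refine Finset.sum_congr rfl fun A _ => ?_
    rw [isingExpect_const_mul' (zdGraph d) (box d L) 0 .free β _ (measurable_spinProduct A)]
    rfl
  simp only [h]
  exact tendsto_finsetSum _ fun A _ => (hasBoxLimit_isingCorr_free_holds (d := d) hβ le_rfl A).const_mul _

/-- If the free and plus states agree on all spin products (boundary-condition independence,
BGJS §3 d)), they agree on every spin polynomial. [cite: BenettinGallavottiJonaLasinioStella1973, §3 d)] -/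
theorem freeExpect_eq_plusExpect_of_corr_eq {β : ℝ} (hβ : 0 ≤ β)
    (hcorr : ∀ A : Finset (Site d), freeCorr d β 0 A = plusCorr d β 0 A)
    {f : SpinConfig (Site d) → ℝ} (hf : IsSpinPolynomial f) :
    freeExpect d β 0 f = plusExpect d β 0 f := by
  obtain ⟨S, c, rfl⟩ := hf
  rw [freeExpect_spinPolynomial hβ, plusExpect_spinPolynomial hβ]
  exact Finset.sum_congr rfl fun A _ => by rw [hcorr A]

end SpinPolynomial

/-! ### The duality relations with boundary conditions, as named facts -/

/-- **BGJS Appendix, eq. (A.10), open → closed, finite volume** (Benettin–Gallavotti–Jona-Lasinio–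
Stella, CMP 30 (1973), App. c), eq. (A.10) with b): "Consider a `N × M` rectangular lattice `Λ` with
open boundary conditions and a second lattice `Λ*`, obtained from `Λ` by drawing a unit segment `b*`
perpendicular to each link `b` of `Λ` at its middle point; for `Λ*` we choose closed boundary
conditions … `⟨σ_xσ_y⟩_B(β) = ⟨∏_{b* ∈ Γ*} (ch 2β*J − σ_{b*} sh 2β*J)⟩_{B*}(β*)` where, for
`B = open`, `B* = closed`", `Γ` "an arbitrary path connecting the two sites `x` and `y`,
constituted by the lattice bonds `b₁, …, bₙ`", `Γ*` the dual bonds, `e^{-2β*} = tanh β`).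
For the nearest-neighbour Ising model on `ℤ²` at zero field and `β > 0`: for every rectangle of
sites `R = [a, b]`, all `x, y ∈ R` and every lattice path `Γ` from `x` to `y` inside `R`
(so `a ≤ b` coordinatewise), the free two-point function `⟨σ_xσ_y⟩^∅_{R;β,0}` equals the plus expectation,
in the rectangle of faces `[a, b − (1,1)]` at `β*`, of the disorder observable of `Γ`. [cite: BenettinGallavottiJonaLasinioStella1973, Appendix, eq. (A.10)] -/
def kw_free_plus_finite : Prop :=
  ∀ ⦃β : ℝ⦄, 0 < β → ∀ (a b x y : Site 2) (p : (zdGraph 2).Walk x y),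
    p.IsPath → (∀ z ∈ p.support, z ∈ Finset.Icc a b) →
      isingTwoPoint (zdGraph 2) (Finset.Icc a b) β 0 .free x y =
        isingExpect (zdGraph 2) (Finset.Icc a (b - 1)) (dualBeta β) 0 .plus
          (kwDisorder (dualBeta β) p.edges)

/-- **BGJS Appendix, eq. (A.10), closed → open, finite volume** (same source, "for `B` = closed,
`B*` = open"; the low-temperature polygons of the closed `[a,b]`-rectangle live on the dual bonds
crossing the bonds touching `[a,b]`, i.e. on the open rectangle of faces `[a − (1,1), b]`).
For `β > 0`, every rectangle `R = [a, b]`, `x, y ∈ R` and every lattice path `Γ` from `x` to `y`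
inside `R`: the plus two-point function `⟨σ_xσ_y⟩⁺_{R;β,0}` equals the free expectation, in the
rectangle of faces `[a − (1,1), b]` at `β*`, of the disorder observable of `Γ`. [cite: BenettinGallavottiJonaLasinioStella1973, Appendix, eq. (A.10)] -/
def kw_plus_free_finite : Prop :=
  ∀ ⦃β : ℝ⦄, 0 < β → ∀ (a b x y : Site 2) (p : (zdGraph 2).Walk x y),
    p.IsPath → (∀ z ∈ p.support, z ∈ Finset.Icc a b) →
      isingTwoPoint (zdGraph 2) (Finset.Icc a b) β 0 .plus x y =
        isingExpect (zdGraph 2) (Finset.Icc (a - 1) b) (dualBeta β) 0 .free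
          (kwDisorder (dualBeta β) p.edges)

/-- **BGJS eq. (2.3) for the pair correlation, thermodynamic limit** (Benettin–Gallavotti–
Jona-Lasinio–Stella, CMP 30 (1973), §2, eq. (2.3): "`⟨σ_X⟩_a(β) = ⟨∏_{b*∈Γ*}[ch(2β*J) − σ_{b*}
sh(2β*J)]⟩_+(β*)`", "valid also in the thermodynamic limit", with `X = {0, x}` and `Γ` a lattice
path from `0` to `x`; App. c): "(A.10) holds also in the thermodynamic limit"). For the
nearest-neighbour Ising model on `ℤ²`, `β > 0`, every `x` and every lattice path `Γ` from `0` to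
`x`: `⟨σ₀σ_x⟩^∅_{β,0} = ⟨∏_{b∈Γ}(cosh 2β* − σ_{b*} sinh 2β*)⟩⁺_{β*,0}` (prelude `twoPointFree`,
`plusExpect`, box limits). [cite: BenettinGallavottiJonaLasinioStella1973, eq. (2.3)] -/
def kw_free_plus : Prop :=
  ∀ ⦃β : ℝ⦄, 0 < β → ∀ (x : Site 2) (p : (zdGraph 2).Walk 0 x), p.IsPath →
    twoPointFree 2 β x = plusExpect 2 (dualBeta β) 0 (kwDisorder (dualBeta β) p.edges)

/-- **BGJS eq. (2.4) for the pair correlation, thermodynamic limit** (same source, eq. (2.4):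
"`⟨σ_X⟩_+(β) = ⟨∏_{b*∈Γ*}[ch(2β*J) − σ_{b*} sh(2β*J)]⟩_a(β*)`"). For `β > 0`, every `x` and every
lattice path `Γ` from `0` to `x`: `⟨σ₀σ_x⟩⁺_{β,0} = ⟨∏_{b∈Γ}(cosh 2β* − σ_{b*} sinh 2β*)⟩^∅_{β*,0}`
(prelude `twoPointPlus`, `freeExpect`). [cite: BenettinGallavottiJonaLasinioStella1973, eq. (2.4)] -/
def kw_plus_free : Prop :=
  ∀ ⦃β : ℝ⦄, 0 < β → ∀ (x : Site 2) (p : (zdGraph 2).Walk 0 x), p.IsPath →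
    twoPointPlus 2 β x = freeExpect 2 (dualBeta β) 0 (kwDisorder (dualBeta β) p.edges)

end Literature.Probability.LatticeModels

/-! ## Part II. Proofs: the duality relations discharged

The remainder of this file discharges the four named facts above (`kw_free_plus_finite_holds`,
`kw_plus_free_finite_holds`, `kw_free_plus_holds`, `kw_plus_free_holds`) along BGJS's printed
route (Appendix a)–c)): the high-temperature expansion of the open (free) model, the
low-temperature (polygon) expansion of the closed (plus) model on the rectangle of faces, the
identification of the closed multipolygons of the one with those of the other, and the passage
to the thermodynamic limit along boxes.

### Route

* Anchored lattice bonds `(u, i) ↔ {u, u + eᵢ}` of `ℤ²` (`AEdge`, `anch Λ`), their endpoints,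
  degrees and odd-degree sets; the crossing map `(u,i) ↦ (u − e_{1−i}, 1−i)` to the dual bond
  (`dualPair_toSym2`: it matches `dualPair`).
* **High-temperature expansion** (BGJS (A.1)–(A.3)) of the free finite-volume model on any
  `Λ ⊂ ℤ²` with bond-dependent activities: `∑_τ σ_A ∏_b (1 + s_b σ_b) = 2^{|Λ|} ∑_{∂F = A} ∏_{b∈F} s_b`
  (`sum_spinProduct_mul_prod_eq`), whence `⟨σ_A⟩^∅_Λ = ∑_{∂F=A} t^{|F|} / ∑_{∂F=∅} t^{|F|}`,
  `t = tanh β` (`isingCorr_free_eq_ratio`), and the disorder insertion flips the sign of `t` on the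
  crossed bonds (`isingExpect_free_disorder_eq_ratio`, the identity (A.8)–(A.9)).
* **Low-temperature expansion** (BGJS (A.4)) of the plus model on a rectangle of faces
  `Q = [c, d]` relative to the bonds of the rectangle of sites `S = [c, d + (1,1)]`: the map
  "configuration ↦ set of bonds of `S` separating opposite spins" (`sepSet`) is a bijection onto
  the even bond sets of `S` (evenness by the plaquette identity `even_adeg_sepSet`, injectivity by
  columns `sepSet_glue_injective`, surjectivity by the explicit parity construction
  `cfgOf F = (−1)^{#crossings above}` and the even-cut lemma `even_card_cut`), with Boltzmann
  weight `∝ e^{-2β'|F|}` (`isingWeight_plus_faces_eq`).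
* Assembly of (A.10) in both directions (the closed → open direction by translating the sites
  onto the faces `[a−(1,1), b−(1,1)]`, `isingExpect_plus_shift`), the shift by the path
  (`sum_bondSets_shift`, BGJS (A.8)), and the limits along boxes.
-/
open MeasureTheory Filter Topology Finset Literature.Probability.LatticeModels Literature.Probability.Percolation
open scoped symmDiff

namespace Literature.Probability.LatticeModels

/-! ### Anchored bonds of `ℤ²` -/

/-- An **anchored bond** of `ℤ²`: the pair `(u, i)` stands for the lattice bond `{u, u + eᵢ}`
(every bond of `ℤ²` has exactly one such representation). [folklore] -/
abbrev AEdge : Type := Site 2 × Fin 2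

namespace AEdge

/-- The unit vector `eᵢ ∈ ℤ²`. [folklore] -/
def vec (i : Fin 2) : Site 2 := Pi.single i 1

/-- `eᵢ i = 1`. [folklore] -/
@[simp] theorem vec_apply_same (i : Fin 2) : vec i i = 1 := by simp [vec]

/-- `eᵢ j = 0` for `j ≠ i`. [folklore] -/
theorem vec_apply_ne {i j : Fin 2} (h : j ≠ i) : vec i j = 0 := by simp [vec, h]

/-- `e₀ 1 = 0`. [folklore] -/
@[simp] theorem vec_zero_apply_one : vec 0 1 = 0 := vec_apply_ne (by decide)
/-- `e₁ 0 = 0`. [folklore] -/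
@[simp] theorem vec_one_apply_zero : vec 1 0 = 0 := vec_apply_ne (by decide)

/-- Unit vectors are nonzero. [folklore] -/
theorem vec_ne_zero (i : Fin 2) : vec i ≠ 0 := by
  intro h; have := congr_fun h i; simp at this

/-- The second endpoint `u + eᵢ` of the anchored bond `(u, i)`. [folklore] -/
def tip (ε : AEdge) : Site 2 := ε.1 + vec ε.2

/-- The lattice bond `{u, u + eᵢ}` of an anchored bond. [folklore] -/
def toSym2 (ε : AEdge) : Sym2 (Site 2) := s(ε.1, ε.tip)

/-- The two endpoints of an anchored bond are distinct. [folklore] -/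
theorem fst_ne_tip (ε : AEdge) : ε.1 ≠ ε.tip := by
  intro h
  have : vec ε.2 = 0 := by
    have h' := congrArg (fun z => z - ε.1) h
    simpa [tip] using h'.symm
  exact vec_ne_zero _ this

/-- Anchored bonds are bonds of `ℤ²`. [folklore] -/
theorem adj (ε : AEdge) : (zdGraph 2).Adj ε.1 ε.tip :=
  (zdGraph_adj_iff _ _).2 ⟨ε.2, Or.inl rfl⟩

/-- `toSym2` is injective. [folklore] -/
theorem toSym2_injective : Function.Injective toSym2 := by
  rintro ⟨u, i⟩ ⟨v, j⟩ h
  simp only [toSym2, tip, Sym2.eq_iff] at h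
  rcases h with ⟨h1, h2⟩ | ⟨h1, h2⟩
  · subst h1
    have hij : vec i = vec j := add_left_cancel h2
    have : i = j := by
      by_contra hne
      have := congr_fun hij i
      rw [vec_apply_same, vec_apply_ne hne] at this
      exact one_ne_zero this
    subst this; rfl
  · exfalso
    have : vec i + vec j = 0 := by
      have h3 := h2; rw [h1] at h3
      have h4 : v + (vec j + vec i) = v + 0 := by rw [← add_assoc, h3, add_zero]
      rw [add_comm (vec j)] at h4
      exact add_left_cancel h4
    have hi := congr_fun this i
    simp only [Pi.add_apply, vec_apply_same, Pi.zero_apply] at hi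
    by_cases hji : i = j
    · subst hji; rw [vec_apply_same] at hi; omega
    · rw [vec_apply_ne hji] at hi; omega

/-- Every bond of `ℤ²` is an anchored bond. [folklore] -/
theorem exists_of_adj {x y : Site 2} (h : (zdGraph 2).Adj x y) : ∃ ε : AEdge, toSym2 ε = s(x, y) := by
  obtain ⟨i, h | h⟩ := (zdGraph_adj_iff x y).1 h
  · exact ⟨(x, i), by simp [toSym2, tip, vec, h]⟩
  · exact ⟨(y, i), by rw [Sym2.eq_swap]; simp [toSym2, tip, vec, h]⟩

end AEdge

open AEdge

/-- The anchored bonds inside a finite volume `Λ ⊂ ℤ²` (both endpoints in `Λ`): the bond set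
`ℰ_Λ` of the free boundary condition. [folklore] -/
def anch (Λ : Finset (Site 2)) : Finset AEdge :=
  (Λ ×ˢ Finset.univ).filter fun ε => ε.tip ∈ Λ

/-- Membership in `ℰ_Λ` (anchored form). [folklore] -/
theorem mem_anch {Λ : Finset (Site 2)} {ε : AEdge} : ε ∈ anch Λ ↔ ε.1 ∈ Λ ∧ ε.tip ∈ Λ := by
  simp [anch]

/-- `ℰ_Λ` as the image of the anchored bonds. [folklore] -/
theorem edgesIn_eq_image_anch (Λ : Finset (Site 2)) : edgesIn (zdGraph 2) Λ = (anch Λ).image toSym2 := by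
  classical
  ext e
  rw [mem_edgesIn_iff, Finset.mem_image]
  constructor
  · rintro ⟨he, hΛ⟩
    induction e using Sym2.ind with
    | _ x y =>
      have hadj : (zdGraph 2).Adj x y := by rwa [SimpleGraph.mem_edgeSet] at he
      obtain ⟨ε, hε⟩ := exists_of_adj hadj
      refine ⟨ε, mem_anch.2 ⟨?_, ?_⟩, hε⟩
      · apply hΛ; rw [← hε, toSym2]; exact Sym2.mem_mk_left _ _
      · apply hΛ; rw [← hε, toSym2]; exact Sym2.mem_mk_right _ _
  · rintro ⟨ε, hε, rfl⟩
    rw [mem_anch] at hε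
    refine ⟨?_, ?_⟩
    · rw [toSym2, SimpleGraph.mem_edgeSet]; exact ε.adj
    · intro x hx
      rw [toSym2, Sym2.mem_iff] at hx
      rcases hx with rfl | rfl
      · exact hε.1
      · exact hε.2

/-- **Sums over `ℰ_Λ` are sums over anchored bonds.** [folklore] -/
theorem sum_edgesIn_eq_sum_anch (Λ : Finset (Site 2)) (g : Sym2 (Site 2) → ℝ) :
    ∑ e ∈ edgesIn (zdGraph 2) Λ, g e = ∑ ε ∈ anch Λ, g (toSym2 ε) := by
  classical
  rw [edgesIn_eq_image_anch, Finset.sum_image fun ε _ ε' _ h => toSym2_injective h]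

/-- The anchored bonds touching `Λ` (at least one endpoint in `Λ`): the bond set `ℰ^b_Λ`. [folklore] -/
def anchT (Λ : Finset (Site 2)) : Finset AEdge :=
  ((Λ ∪ Finset.univ.biUnion fun i : Fin 2 => Λ.image fun u => u - vec i) ×ˢ Finset.univ).filter
    fun ε => ε.1 ∈ Λ ∨ ε.tip ∈ Λ

/-- Membership in `ℰ^b_Λ` (anchored form). [folklore] -/
theorem mem_anchT {Λ : Finset (Site 2)} {ε : AEdge} : ε ∈ anchT Λ ↔ ε.1 ∈ Λ ∨ ε.tip ∈ Λ := by
  simp only [anchT, Finset.mem_filter, Finset.mem_product, Finset.mem_univ, and_true,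
    Finset.mem_union, Finset.mem_biUnion, Finset.mem_image, true_and, and_iff_right_iff_imp]
  rintro (h | h)
  · exact Or.inl h
  · exact Or.inr ⟨ε.2, ε.tip, h, by simp [tip]⟩

/-- **Sums over `ℰ^b_Λ` are sums over anchored bonds.** [folklore] -/
theorem sum_edgesTouching_eq_sum_anchT (Λ : Finset (Site 2)) (g : Sym2 (Site 2) → ℝ) :
    ∑ e ∈ edgesTouching (zdGraph 2) Λ, g e = ∑ ε ∈ anchT Λ, g (toSym2 ε) := by
  classical
  have himage : edgesTouching (zdGraph 2) Λ = (anchT Λ).image toSym2 := by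
    ext e
    rw [mem_edgesTouching_iff, Finset.mem_image]
    constructor
    · rintro ⟨he, x, hxΛ, hxe⟩
      induction e using Sym2.ind with
      | _ a b =>
        have hadj : (zdGraph 2).Adj a b := by rwa [SimpleGraph.mem_edgeSet] at he
        obtain ⟨ε, hε⟩ := exists_of_adj hadj
        refine ⟨ε, mem_anchT.2 ?_, hε⟩
        rw [← hε, toSym2, Sym2.mem_iff] at hxe
        rcases hxe with rfl | rfl
        · exact Or.inl hxΛ
        · exact Or.inr hxΛ
    · rintro ⟨ε, hε, rfl⟩
      rw [mem_anchT] at hε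
      refine ⟨?_, ?_⟩
      · rw [toSym2, SimpleGraph.mem_edgeSet]; exact ε.adj
      · rcases hε with h | h
        · exact ⟨ε.1, h, Sym2.mem_mk_left _ _⟩
        · exact ⟨ε.tip, h, Sym2.mem_mk_right _ _⟩
  rw [himage, Finset.sum_image fun ε _ ε' _ h => toSym2_injective h]

/-! ### Bond variables, degrees and odd-degree sets -/

/-- The bond variable `σ_u σ_{u+eᵢ}` of an anchored bond. [folklore] -/
def bE (ε : AEdge) (σ : SpinConfig (Site 2)) : ℝ := spinAt ε.1 σ * spinAt ε.tip σ

/-- The bond variable of the bond of an anchored bond is its anchored bond variable. [folklore] -/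
theorem bondSpin_toSym2 (σ : SpinConfig (Site 2)) (ε : AEdge) : bondSpin σ (toSym2 ε) = bE ε σ := rfl

/-- Bond variables take the values `±1`. [folklore] -/
theorem bE_eq_one_or (ε : AEdge) (σ : SpinConfig (Site 2)) : bE ε σ = 1 ∨ bE ε σ = -1 := by
  rw [← bondSpin_toSym2]; exact bondSpin_eq_one_or σ _

/-- Bond variables square to `1`. [folklore] -/
theorem bE_sq (ε : AEdge) (σ : SpinConfig (Site 2)) : bE ε σ * bE ε σ = 1 := by
  rcases bE_eq_one_or ε σ with h | h <;> rw [h] <;> norm_num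

/-- The degree of a site in a set of anchored bonds. [folklore] -/
def adeg (F : Finset AEdge) (v : Site 2) : ℕ := #(F.filter fun ε => v = ε.1 ∨ v = ε.tip)

/-- The sites of `Λ` of odd degree in `F` (`∂F`). [folklore] -/
def oddSet (Λ : Finset (Site 2)) (F : Finset AEdge) : Finset (Site 2) :=
  Λ.filter fun v => Odd (adeg F v)

/-- Membership in the odd-degree set `∂F`. [folklore] -/
theorem mem_oddSet {Λ : Finset (Site 2)} {F : Finset AEdge} {v : Site 2} :
    v ∈ oddSet Λ F ↔ v ∈ Λ ∧ Odd (adeg F v) := Finset.mem_filter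

/-- Regrouping a product of bond variables of bonds inside `Λ` by sites:
`∏_{b ∈ F} σ_b = ∏_{z ∈ Λ} σ_z^{deg_F z}` on configurations glued into `Λ`. [folklore] -/
theorem prod_bE_glue_eq {Λ : Finset (Site 2)} {F : Finset AEdge} (hF : F ⊆ anch Λ)
    (τ : ↥Λ → ℤˣ) (bc : BoundaryCondition (Site 2)) :
    ∏ ε ∈ F, bE ε (glue Λ τ bc) = ∏ z : ↥Λ, spinAt z τ ^ adeg F (z : Site 2) := by
  classical
  -- each bond variable as a product over the sites of `Λ`
  have hone : ∀ ε ∈ F, bE ε (glue Λ τ bc) =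
      ∏ z : ↥Λ, spinAt z τ ^ (if (z : Site 2) = ε.1 ∨ (z : Site 2) = ε.tip then 1 else 0) := by
    intro ε hε
    have hε' := mem_anch.1 (hF hε)
    have hsplit : ∀ z : ↥Λ, (if (z : Site 2) = ε.1 ∨ (z : Site 2) = ε.tip then 1 else 0) =
        (if (z : Site 2) = ε.1 then 1 else 0) + (if (z : Site 2) = ε.tip then 1 else 0) := by
      intro z
      by_cases h1 : (z : Site 2) = ε.1
      · have h2 : (z : Site 2) ≠ ε.tip := by rw [h1]; exact ε.fst_ne_tip
        simp [h1, ε.fst_ne_tip]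
      · by_cases h2 : (z : Site 2) = ε.tip
        · simp [h2, ε.fst_ne_tip.symm]
        · simp [h1, h2]
    simp_rw [hsplit, pow_add, Finset.prod_mul_distrib]
    have hsingle : ∀ (a : Site 2) (ha : a ∈ Λ),
        ∏ z : ↥Λ, spinAt z τ ^ (if (z : Site 2) = a then 1 else 0) = spinAt (⟨a, ha⟩ : ↥Λ) τ := by
      intro a ha
      rw [Finset.prod_eq_single ⟨a, ha⟩]
      · simp
      · intro z _ hz
        have : (z : Site 2) ≠ a := fun h => hz (Subtype.ext h)
        simp [this]
      · intro h; exact absurd (Finset.mem_univ _) h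
    rw [hsingle ε.1 hε'.1, hsingle ε.tip hε'.2, bE, spinAt_glue_of_mem τ bc hε'.1,
      spinAt_glue_of_mem τ bc hε'.2]
  rw [Finset.prod_congr rfl hone, Finset.prod_comm]
  refine Finset.prod_congr rfl fun z _ => ?_
  rw [Finset.prod_pow_eq_pow_sum, adeg, Finset.card_eq_sum_ones, Finset.sum_filter]

/-- **The site sums of the high-temperature expansion** (BGJS (A.2)–(A.3): the term of a bond
set `γ` "contributes only if" every site has even degree, here with a source insertion `σ_A`):
for `F ⊆ ℰ_Λ` and `A ⊆ Λ`, `∑_τ σ_A(τ) ∏_{b∈F} σ_b(τ) = 2^{|Λ|}` if `∂F = A` and `0` otherwise. [cite: BenettinGallavottiJonaLasinioStella1973, Appendix a), eqs. (A.2)–(A.3)] -/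
theorem sum_spinProduct_mul_prod_bE {Λ : Finset (Site 2)} {F : Finset AEdge} (hF : F ⊆ anch Λ)
    {A : Finset (Site 2)} (hA : A ⊆ Λ) (bc : BoundaryCondition (Site 2)) :
    ∑ τ : ↥Λ → ℤˣ, spinProduct A (glue Λ τ bc) * ∏ ε ∈ F, bE ε (glue Λ τ bc) =
      if oddSet Λ F = A then (2 : ℝ) ^ #Λ else 0 := by
  classical
  -- regroup by sites
  have hreg : ∀ τ : ↥Λ → ℤˣ, spinProduct A (glue Λ τ bc) * ∏ ε ∈ F, bE ε (glue Λ τ bc) =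
      ∏ z : ↥Λ, spinAt z τ ^ ((if (z : Site 2) ∈ A then 1 else 0) + adeg F (z : Site 2)) := by
    intro τ
    rw [prod_bE_glue_eq hF τ bc, spinProduct_glue_of_subset hA τ bc, ← prod_spinAt_pow_indicator,
      ← Finset.prod_mul_distrib]
    refine Finset.prod_congr rfl fun z _ => ?_
    rw [← pow_add]
    congr 1
    simp [inVol]
  simp_rw [hreg]
  have h : ∑ τ : ↥Λ → ℤˣ, ∏ z : ↥Λ, spinAt z τ ^ ((if (z : Site 2) ∈ A then 1 else 0) + adeg F z) =
      ∏ z : ↥Λ, ∑ u : ℤˣ, (((u : ℤ) : ℝ)) ^ ((if (z : Site 2) ∈ A then 1 else 0) + adeg F z) := by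
    rw [Fintype.prod_sum]
    rfl
  rw [h]
  have hunits : ∀ m : ℕ, ∑ u : ℤˣ, (((u : ℤ) : ℝ)) ^ m = if Even m then 2 else 0 := by
    intro m
    rw [UnitsInt.univ, Finset.sum_insert (by decide), Finset.sum_singleton]
    simp only [Units.val_one, Int.cast_one, one_pow, Units.val_neg, Int.cast_neg]
    rcases Nat.even_or_odd m with h | h
    · rw [h.neg_one_pow, if_pos h]; norm_num
    · rw [h.neg_one_pow, if_neg (Nat.not_even_iff_odd.2 h)]; norm_num
  simp_rw [hunits]
  -- parity bookkeeping
  have hiff : oddSet Λ F = A ↔ ∀ z : ↥Λ, Even ((if (z : Site 2) ∈ A then 1 else 0) + adeg F z) := by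
    constructor
    · intro hs z
      have hz : (z : Site 2) ∈ A ↔ Odd (adeg F z) := by
        rw [← hs, mem_oddSet]; exact ⟨fun h => h.2, fun h => ⟨z.2, h⟩⟩
      by_cases hzA : (z : Site 2) ∈ A
      · rw [if_pos hzA, add_comm]; exact (hz.1 hzA).add_one
      · rw [if_neg hzA, zero_add]; exact Nat.not_odd_iff_even.1 fun h => hzA (hz.2 h)
    · intro hall
      ext v
      rw [mem_oddSet]
      constructor
      · rintro ⟨hv, hodd⟩
        have h := hall ⟨v, hv⟩
        by_contra hvA
        simp only [hvA, if_false, zero_add] at h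
        exact (Nat.not_even_iff_odd.2 hodd) h
      · intro hvA
        refine ⟨hA hvA, ?_⟩
        have h := hall ⟨v, hA hvA⟩
        simp only [hvA, if_true] at h
        rcases Nat.even_or_odd (adeg F v) with h' | h'
        · exact absurd h (Nat.not_even_iff_odd.2 (by rw [add_comm]; exact h'.add_one))
        · exact h'
  by_cases hs : oddSet Λ F = A
  · rw [if_pos hs]
    have hall := hiff.1 hs
    rw [Finset.prod_congr rfl fun z _ => if_pos (hall z), Finset.prod_const, Finset.card_univ,
      Fintype.card_coe]
  · rw [if_neg hs]
    have hex : ∃ z : ↥Λ, ¬Even ((if (z : Site 2) ∈ A then 1 else 0) + adeg F z) := by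
      by_contra hcon
      push Not at hcon
      exact hs (hiff.2 hcon)
    obtain ⟨z, hz⟩ := hex
    exact Finset.prod_eq_zero (Finset.mem_univ z) (if_neg hz)

/-- **The high-temperature expansion with bond-dependent activities** (BGJS (A.1)–(A.3),
`Z_B = 2^L ∏ ch K_b ∑_γ T(γ)`, `T = ∏_{b∈γ} th K_b`, here for the free measure with a source
insertion): for `A ⊆ Λ` and any activities `s_b`,
`∑_τ σ_A(τ) ∏_{b ∈ ℰ_Λ} (1 + s_b σ_b(τ)) = 2^{|Λ|} ∑_{F ⊆ ℰ_Λ, ∂F = A} ∏_{b∈F} s_b`. [cite: BenettinGallavottiJonaLasinioStella1973, Appendix a), eqs. (A.1)–(A.3)] -/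
theorem sum_spinProduct_mul_prod_eq {Λ : Finset (Site 2)} {A : Finset (Site 2)} (hA : A ⊆ Λ)
    (s : AEdge → ℝ) (bc : BoundaryCondition (Site 2)) :
    ∑ τ : ↥Λ → ℤˣ, spinProduct A (glue Λ τ bc) * ∏ ε ∈ anch Λ, (1 + s ε * bE ε (glue Λ τ bc)) =
      (2 : ℝ) ^ #Λ * ∑ F ∈ (anch Λ).powerset.filter (fun F => oddSet Λ F = A), ∏ ε ∈ F, s ε := by
  classical
  have hexp : ∀ τ : ↥Λ → ℤˣ, ∏ ε ∈ anch Λ, (1 + s ε * bE ε (glue Λ τ bc)) =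
      ∑ F ∈ (anch Λ).powerset, (∏ ε ∈ F, s ε) * ∏ ε ∈ F, bE ε (glue Λ τ bc) := by
    intro τ
    have h := Finset.prod_add (fun ε => s ε * bE ε (glue Λ τ bc)) (fun _ => (1 : ℝ)) (anch Λ)
    simp only [Finset.prod_const_one, mul_one] at h
    rw [show (∏ ε ∈ anch Λ, (1 + s ε * bE ε (glue Λ τ bc))) =
        ∏ ε ∈ anch Λ, (s ε * bE ε (glue Λ τ bc) + 1) from Finset.prod_congr rfl fun _ _ => add_comm _ _,
      h]
    exact Finset.sum_congr rfl fun F _ => Finset.prod_mul_distrib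
  simp_rw [hexp, Finset.mul_sum]
  rw [Finset.sum_comm]
  rw [Finset.sum_filter]
  refine Finset.sum_congr rfl fun F hF => ?_
  rw [Finset.mem_powerset] at hF
  have key := sum_spinProduct_mul_prod_bE hF hA bc
  have hrw : ∑ τ : ↥Λ → ℤˣ, spinProduct A (glue Λ τ bc) * ((∏ ε ∈ F, s ε) * ∏ ε ∈ F, bE ε (glue Λ τ bc)) =
      (∏ ε ∈ F, s ε) * ∑ τ : ↥Λ → ℤˣ, spinProduct A (glue Λ τ bc) * ∏ ε ∈ F, bE ε (glue Λ τ bc) := by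
    rw [Finset.mul_sum]
    exact Finset.sum_congr rfl fun τ _ => by ring
  rw [hrw, key]
  split_ifs <;> ring

/-! ### The free Boltzmann weight in high-temperature form -/

/-- The free Hamiltonian of a finite volume of `ℤ²` at zero field as a sum over anchored bonds:
`-H^∅_{Λ;0}(σ) = ∑_{b ∈ ℰ_Λ} σ_b`. [cite: FriedliVelenik2017, §3.1, eq. (3.2)] -/
theorem neg_isingHamiltonian_free_zero_eq (Λ : Finset (Site 2)) (σ : SpinConfig (Site 2)) :
    -isingHamiltonian (zdGraph 2) Λ 0 .free σ = ∑ ε ∈ anch Λ, bE ε σ := by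
  simp only [isingHamiltonian, interactionEdges_free, zero_mul, sub_zero, neg_neg]
  rw [sum_edgesIn_eq_sum_anch]
  rfl

/-- **High-temperature *product* form of the free Boltzmann weight** (BGJS (A.1): `e^{K σ_b} =
ch K (1 + σ_b th K)`): `w^∅_{Λ;β,0}(τ) = (cosh β)^{|ℰ_Λ|} ∏_{b ∈ ℰ_Λ} (1 + tanh β · σ_b)` over the
anchored bonds — the unexpanded form needed for bond-dependent activities (the tree's
`Literature.Probability.LatticeModels.isingWeight_free_zero_field_eq` is the expanded sum over bond sets). [cite: BenettinGallavottiJonaLasinioStella1973, Appendix a), eq. (A.1)] -/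
theorem isingWeight_free_zero_eq (Λ : Finset (Site 2)) (β : ℝ) (τ : ↥Λ → ℤˣ) :
    isingWeight (zdGraph 2) Λ β 0 .free τ =
      Real.cosh β ^ #(anch Λ) * ∏ ε ∈ anch Λ, (1 + Real.tanh β * bE ε (glue Λ τ .free)) := by
  rw [isingWeight, show -β * isingHamiltonian (zdGraph 2) Λ 0 .free (glue Λ τ .free) =
      β * -isingHamiltonian (zdGraph 2) Λ 0 .free (glue Λ τ .free) by ring,
    neg_isingHamiltonian_free_zero_eq, Finset.mul_sum, Real.exp_sum]
  have hcosh : (0 : ℝ) < Real.cosh β := Real.cosh_pos β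
  have h1 : ∀ ε ∈ anch Λ, Real.exp (β * bE ε (glue Λ τ .free)) =
      Real.cosh β * (1 + Real.tanh β * bE ε (glue Λ τ .free)) := by
    intro ε _
    rw [← bondSpin_toSym2, exp_mul_bondSpin, Real.tanh_eq_sinh_div_cosh]
    field_simp
  rw [Finset.prod_congr rfl h1, Finset.prod_mul_distrib, Finset.prod_const]

/-- The bond sets `{F ⊆ ℰ_Λ : ∂F = B}` of the high-temperature expansion in anchored form
(BGJS (A.3): the `γ`'s "which, for the given boundary condition, furnish a non vanishing
contribution"): the index set of the tree's `Literature.Probability.LatticeModels.hteSum` (`ModifiedSimonInequality`)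
transported to anchored bonds, see `sum_bondSets_pow_eq_hteSum`. [cite: BenettinGallavottiJonaLasinioStella1973, Appendix a), eq. (A.3)] -/
def bondSets (Λ : Finset (Site 2)) (B : Finset (Site 2)) : Finset (Finset AEdge) :=
  (anch Λ).powerset.filter fun F => oddSet Λ F = B

/-- Membership in the polygon sets `{F ⊆ ℰ_Λ : ∂F = B}`. [folklore] -/
theorem mem_bondSets {Λ : Finset (Site 2)} {B : Finset (Site 2)} {F : Finset AEdge} :
    F ∈ bondSets Λ B ↔ F ⊆ anch Λ ∧ oddSet Λ F = B := by
  rw [bondSets, Finset.mem_filter, Finset.mem_powerset]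

/-- The empty bond set is closed: `∅ ∈ {F : ∂F = ∅}`. [folklore] -/
theorem empty_mem_bondSets (Λ : Finset (Site 2)) : (∅ : Finset AEdge) ∈ bondSets Λ ∅ := by
  rw [mem_bondSets]
  refine ⟨Finset.empty_subset _, ?_⟩
  ext v
  simp [mem_oddSet, adeg]

/-! ### Bridges to the tree's high-temperature expansion (`ModifiedSimonInequality`) -/

/-- The anchored degree is the degree in the image bond set: `deg_F v = #{e ∈ toSym2(F) : v ∈ e}`. [folklore] -/
theorem adeg_eq_card_filter_image (F : Finset AEdge) (v : Site 2) :
    adeg F v = #((F.image toSym2).filter fun e => v ∈ e) := by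
  classical
  rw [adeg, Finset.filter_image, Finset.card_image_of_injective _ toSym2_injective]
  congr 1
  ext ε
  simp only [Finset.mem_filter, toSym2, Sym2.mem_iff]

/-- **The anchored odd-degree set is the tree's `oddVerts` of the image bond set**:
`oddSet Λ F = oddVerts Λ (toSym2(F))`. [folklore] -/
theorem oddSet_eq_oddVerts (Λ : Finset (Site 2)) (F : Finset AEdge) :
    oddSet Λ F = oddVerts Λ (F.image toSym2) := by
  classical
  ext v
  rw [mem_oddSet, oddVerts, Finset.mem_filter, adeg_eq_card_filter_image]

/-- Anchored bond sets inside `Λ` map into the tree's bond set `ℰ_Λ`. [folklore] -/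
theorem image_toSym2_subset_edgesIn {Λ : Finset (Site 2)} {F : Finset AEdge} (hF : F ⊆ anch Λ) :
    F.image toSym2 ⊆ edgesIn (zdGraph 2) Λ := by
  rw [edgesIn_eq_image_anch]
  exact Finset.image_subset_image hF

/-- **The anchored polygon sums are the tree's high-temperature sums**:
`∑_{F ∈ bondSets Λ A} t^{|F|} = hteSum ℤ² Λ t A` (the bijection `F ↦ toSym2(F)` between anchored
bond sets inside `Λ` and subsets of `ℰ_Λ`, preserving cardinality and odd-degree sets). [folklore] -/
theorem sum_bondSets_pow_eq_hteSum (Λ : Finset (Site 2)) (t : ℝ) (A : Finset (Site 2)) :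
    ∑ F ∈ bondSets Λ A, t ^ #F = hteSum (zdGraph 2) Λ t A := by
  classical
  rw [hteSum]
  refine Finset.sum_bij (fun F _ => F.image toSym2) ?_ ?_ ?_ ?_
  · intro F hF
    rw [mem_bondSets] at hF
    refine Finset.mem_filter.2 ⟨Finset.mem_powerset.2 (image_toSym2_subset_edgesIn hF.1), ?_⟩
    rw [← oddSet_eq_oddVerts, hF.2]
  · intro F₁ _ F₂ _ h
    exact Finset.image_injective toSym2_injective h
  · intro F' hF'
    rw [Finset.mem_filter, Finset.mem_powerset, edgesIn_eq_image_anch] at hF'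
    obtain ⟨F, hFsub, hFeq⟩ := Finset.subset_image_iff.1 hF'.1
    refine ⟨F, ?_, hFeq⟩
    rw [mem_bondSets]
    refine ⟨hFsub, ?_⟩
    rw [oddSet_eq_oddVerts, hFeq, hF'.2]
  · intro F _
    rw [Finset.card_image_of_injective _ toSym2_injective]

/-- `|ℰ_Λ| = |anch Λ|`. [folklore] -/
theorem card_edgesIn_eq_card_anch (Λ : Finset (Site 2)) : #(edgesIn (zdGraph 2) Λ) = #(anch Λ) := by
  classical
  rw [edgesIn_eq_image_anch, Finset.card_image_of_injective _ toSym2_injective]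

/-- The free partition function in high-temperature form (the tree's
`isingPartitionFunction_free_eq_hteSum`, Duminil-Copin 2016 §2.2.1, in anchored form; BGJS (A.3)):
`Z^∅_{Λ;β,0} = (cosh β)^{|ℰ_Λ|} 2^{|Λ|} ∑_{∂F = ∅} t^{|F|}`. [cite: BenettinGallavottiJonaLasinioStella1973, Appendix a), eq. (A.3)] -/
theorem isingPartitionFunction_free_zero_eq (Λ : Finset (Site 2)) (β : ℝ) :
    isingPartitionFunction (zdGraph 2) Λ β 0 .free =
      Real.cosh β ^ #(anch Λ) * (2 : ℝ) ^ #Λ * ∑ F ∈ bondSets Λ ∅, Real.tanh β ^ #F := by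
  classical
  rw [isingPartitionFunction_free_eq_hteSum, sum_bondSets_pow_eq_hteSum, card_edgesIn_eq_card_anch,
    Fintype.card_fun, Fintype.card_coe, Fintype.card_units_int]
  push_cast
  ring

/-- **The high-temperature representation of free correlations** in anchored form (the tree's
`isingCorr_free_eq_hteSum_div`, Duminil-Copin 2016 §2.2.1, transported by
`sum_bondSets_pow_eq_hteSum`; BGJS (A.3) with the source insertion of App. c), eq. (A.8);
Kramers–Wannier / van der Waerden): for `A ⊆ Λ ⊂ ℤ²` and any real `β`,
`⟨σ_A⟩^∅_{Λ;β,0} = ∑_{F ⊆ ℰ_Λ, ∂F = A} t^{|F|} / ∑_{F ⊆ ℰ_Λ, ∂F = ∅} t^{|F|}`, `t = tanh β`. [cite: BenettinGallavottiJonaLasinioStella1973, Appendix a), eq. (A.3)] -/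
theorem isingCorr_free_eq_ratio (Λ : Finset (Site 2)) (β : ℝ) {A : Finset (Site 2)} (hA : A ⊆ Λ) :
    isingCorr (zdGraph 2) Λ β 0 .free A =
      (∑ F ∈ bondSets Λ A, Real.tanh β ^ #F) / ∑ F ∈ bondSets Λ ∅, Real.tanh β ^ #F := by
  rw [isingCorr_free_eq_hteSum_div (zdGraph 2) Λ β hA, sum_bondSets_pow_eq_hteSum, sum_bondSets_pow_eq_hteSum]

/-! ### Coordinates, the crossing map, and the disorder insertion -/

/-- Membership in a rectangle of `ℤ²`, coordinatewise. [folklore] -/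
theorem mem_Icc_site {x a b : Site 2} :
    x ∈ Finset.Icc a b ↔ (a 0 ≤ x 0 ∧ x 0 ≤ b 0) ∧ (a 1 ≤ x 1 ∧ x 1 ≤ b 1) := by
  rw [Finset.mem_Icc, Pi.le_def, Pi.le_def, Fin.forall_fin_two, Fin.forall_fin_two]
  tauto

namespace AEdge

/-- `e₀ 0 = 1`. [folklore] -/
@[simp] theorem vec_zero_apply_zero : vec 0 0 = 1 := vec_apply_same 0
/-- `e₁ 1 = 1`. [folklore] -/
@[simp] theorem vec_one_apply_one : vec 1 1 = 1 := vec_apply_same 1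

/-- Coordinates of the second endpoint of an anchored bond. [folklore] -/
@[simp] theorem tip_apply (ε : AEdge) (j : Fin 2) : ε.tip j = ε.1 j + vec ε.2 j := rfl

/-- `Fin.rev 0 = 1` in `Fin 2`. [folklore] -/
@[simp] theorem rev_zero : (0 : Fin 2).rev = 1 := rfl
/-- `Fin.rev 1 = 0` in `Fin 2`. [folklore] -/
@[simp] theorem rev_one : (1 : Fin 2).rev = 0 := rfl

/-- `e_i + e_{1-i} = (1,1)`. [folklore] -/
theorem vec_add_vec_rev (i : Fin 2) : vec i + vec i.rev = 1 := by
  funext j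
  fin_cases i <;> fin_cases j <;> simp

/-- The **crossing map**: the anchored dual bond crossing the anchored bond `(u, i)` joins the
faces `u − e_{1−i}` and `u` (BGJS §2, Fig. 2; see `dualPair_toSym2`). [cite: BenettinGallavottiJonaLasinioStella1973, §2 and Fig. 2] -/
def cross (ε : AEdge) : AEdge := (ε.1 - vec ε.2.rev, ε.2.rev)

/-- The inverse of the crossing map. [folklore] -/
def uncross (δ : AEdge) : AEdge := (δ.tip, δ.2.rev)

/-- First face of the crossing bond. [folklore] -/
@[simp] theorem cross_fst (ε : AEdge) : (cross ε).1 = ε.1 - vec ε.2.rev := rfl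
/-- Direction of the crossing bond. [folklore] -/
@[simp] theorem cross_snd (ε : AEdge) : (cross ε).2 = ε.2.rev := rfl
/-- Second face of the crossing bond: the anchor site itself (as a face label). [folklore] -/
@[simp] theorem cross_tip (ε : AEdge) : (cross ε).tip = ε.1 := by
  simp [cross, tip]
/-- First endpoint of the uncrossing. [folklore] -/
@[simp] theorem uncross_fst (δ : AEdge) : (uncross δ).1 = δ.tip := rfl
/-- Direction of the uncrossing. [folklore] -/
@[simp] theorem uncross_snd (δ : AEdge) : (uncross δ).2 = δ.2.rev := rfl
/-- Second endpoint of the uncrossing: the face label shifted by `(1,1)`. [folklore] -/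
theorem uncross_tip (δ : AEdge) : (uncross δ).tip = δ.1 + 1 := by
  rw [tip, uncross_fst, uncross_snd, tip, add_assoc, vec_add_vec_rev]

/-- `uncross ∘ cross = id`. [folklore] -/
theorem uncross_cross (ε : AEdge) : uncross (cross ε) = ε := by
  obtain ⟨u, i⟩ := ε
  simp [uncross, Fin.rev_rev]

/-- `cross ∘ uncross = id`. [folklore] -/
theorem cross_uncross (δ : AEdge) : cross (uncross δ) = δ := by
  obtain ⟨g, j⟩ := δ
  simp [cross, uncross, tip, Fin.rev_rev]

/-- The crossing map is injective. [folklore] -/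
theorem cross_injective : Function.Injective cross := fun a b h => by
  rw [← uncross_cross a, h, uncross_cross]

end AEdge

/-- **The dual bond of a lattice bond joins the faces of the crossing map**: `dualPair {u, u+eᵢ}
= {u − e_{1−i}, u}`. [cite: BenettinGallavottiJonaLasinioStella1973, §2 and Fig. 2] -/
theorem dualPair_toSym2 (ε : AEdge) : dualPair (toSym2 ε) = {(cross ε).1, (cross ε).tip} := by
  obtain ⟨u, i⟩ := ε
  rw [cross_tip, cross_fst, dualPair_eq_toFinset_dualEdge]
  fin_cases i
  · show (dualEdge s(u, u + Pi.single 0 1)).toFinset = {u - Pi.single 1 1, u}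
    rw [dualEdge_horizontal, Sym2.toFinset_mk_eq]
  · show (dualEdge s(u, u + Pi.single 1 1)).toFinset = {u - Pi.single 0 1, u}
    rw [dualEdge_vertical, Sym2.toFinset_mk_eq]

/-- `σ_{b*}`, the product of the two dual spins of the dual bond `b*` of `b`, is the bond variable
of the crossing anchored bond. [cite: BenettinGallavottiJonaLasinioStella1973, §2] -/
theorem spinProduct_dualPair_toSym2 (ε : AEdge) (σ : SpinConfig (Site 2)) :
    spinProduct (dualPair (toSym2 ε)) σ = bE (cross ε) σ := by
  rw [dualPair_toSym2, spinProduct, Finset.prod_pair (cross ε).fst_ne_tip]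
  rfl

/-- The high/low-temperature identity behind the disorder insertion (BGJS App. c), (A.8)–(A.9):
`K → K + iπ/2`): `(1 + b tanh β')(cosh 2β' − b sinh 2β') = 1 − b tanh β'` for `b = ±1`. [cite: BenettinGallavottiJonaLasinioStella1973, Appendix c), eqs. (A.8)–(A.9)] -/
theorem disorder_factor_identity (β' : ℝ) {b : ℝ} (hb : b = 1 ∨ b = -1) :
    (1 + Real.tanh β' * b) * (Real.cosh (2 * β') - Real.sinh (2 * β') * b) = 1 - Real.tanh β' * b := by
  have hc : (0 : ℝ) < Real.cosh β' := Real.cosh_pos β'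
  have hc0 : Real.cosh β' ≠ 0 := hc.ne'
  have h1 : Real.cosh β' + Real.sinh β' = Real.exp β' := Real.cosh_add_sinh β'
  have h2 : Real.cosh β' - Real.sinh β' = Real.exp (-β') := Real.cosh_sub_sinh β'
  have e1 : Real.cosh (2 * β') - Real.sinh (2 * β') = Real.exp (-(2 * β')) := Real.cosh_sub_sinh _
  have e2 : Real.cosh (2 * β') + Real.sinh (2 * β') = Real.exp (2 * β') := Real.cosh_add_sinh _
  have t_eq : Real.tanh β' = Real.sinh β' / Real.cosh β' := Real.tanh_eq_sinh_div_cosh β'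
  rcases hb with rfl | rfl
  · have key : (Real.cosh β' + Real.sinh β') * Real.exp (-(2 * β')) = Real.cosh β' - Real.sinh β' := by
      rw [h1, h2, ← Real.exp_add]; congr 1; ring
    simp only [mul_one]
    rw [e1, t_eq]
    field_simp
    linear_combination key
  · have key : (Real.cosh β' - Real.sinh β') * Real.exp (2 * β') = Real.cosh β' + Real.sinh β' := by
      rw [h1, h2, ← Real.exp_add]; congr 1; ring
    simp only [mul_neg_one, sub_neg_eq_add]
    rw [e2, t_eq]
    field_simp
    linear_combination key

/-- **The high-temperature representation of the free disorder expectation** (BGJS App. c):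
by (A.8)–(A.9) the insertion of the disorder observable along `Γ*` flips the sign of `tanh` on
the bonds of `Γ`): for `P ⊆ ℰ_Λ`,
`⟨∏_{b∈P}(cosh 2β' − σ_b^× sinh 2β')⟩^∅_{Λ;β',0} = ∑_{∂F=∅} ∏_{b∈F} (±t) / ∑_{∂F=∅} t^{|F|}` with
`−t` on `P` and `t = tanh β'`, `σ_b^×` the bond variable of the crossing bond read in `Λ`. Here
stated for the family of bond variables `bE (cross b)` composed with any relabelling: we use it
with the dual lattice relabelled as `ℤ²`. [cite: BenettinGallavottiJonaLasinioStella1973, Appendix c), eq. (A.10)] -/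
theorem isingExpect_free_disorder_eq_ratio (Λ : Finset (Site 2)) (β' : ℝ) {P : Finset AEdge}
    (hP : P ⊆ anch Λ) :
    isingExpect (zdGraph 2) Λ β' 0 .free
        (fun σ => ∏ ε ∈ P, (Real.cosh (2 * β') - Real.sinh (2 * β') * bE ε σ)) =
      (∑ F ∈ bondSets Λ ∅, ∏ ε ∈ F, (if ε ∈ P then -Real.tanh β' else Real.tanh β')) /
        ∑ F ∈ bondSets Λ ∅, Real.tanh β' ^ #F := by
  classical
  have hmeas : Measurable fun σ : SpinConfig (Site 2) =>
      ∏ ε ∈ P, (Real.cosh (2 * β') - Real.sinh (2 * β') * bE ε σ) :=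
    Finset.measurable_prod _ fun ε _ =>
      measurable_const.sub (measurable_const.mul ((measurable_spinAt _).mul (measurable_spinAt _)))
  rw [isingExpect_eq_sum_div (zdGraph 2) Λ 0 .free β' hmeas, isingPartitionFunction_free_zero_eq]
  set s : AEdge → ℝ := fun ε => if ε ∈ P then -Real.tanh β' else Real.tanh β' with hs
  -- pointwise: weight × observable in high-temperature form with flipped activities on `P`
  have hpt : ∀ τ : ↥Λ → ℤˣ, isingWeight (zdGraph 2) Λ β' 0 .free τ *
      ∏ ε ∈ P, (Real.cosh (2 * β') - Real.sinh (2 * β') * bE ε (glue Λ τ .free)) =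
      Real.cosh β' ^ #(anch Λ) *
        (spinProduct ∅ (glue Λ τ .free) * ∏ ε ∈ anch Λ, (1 + s ε * bE ε (glue Λ τ .free))) := by
    intro τ
    rw [isingWeight_free_zero_eq, spinProduct_empty, one_mul, mul_assoc]
    congr 1
    rw [← Finset.prod_sdiff hP, ← Finset.prod_sdiff hP, mul_assoc, ← Finset.prod_mul_distrib]
    congr 1
    · refine Finset.prod_congr rfl fun ε hε => ?_
      rw [Finset.mem_sdiff] at hε
      simp [hs, hε.2]
    · refine Finset.prod_congr rfl fun ε hε => ?_
      rw [disorder_factor_identity β' (bE_eq_one_or ε _)]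
      simp [hs, hε]
      ring
  rw [Finset.sum_congr rfl fun τ _ => hpt τ, ← Finset.mul_sum,
    sum_spinProduct_mul_prod_eq (Finset.empty_subset Λ) s .free,
    show (anch Λ).powerset.filter (fun F => oddSet Λ F = ∅) = bondSets Λ ∅ from rfl, ← mul_assoc]
  have hc : Real.cosh β' ^ #(anch Λ) * (2 : ℝ) ^ #Λ ≠ 0 := by
    have := Real.cosh_pos β'
    positivity
  rw [mul_div_mul_left _ _ hc]

/-! ### Low-temperature side: face configurations and their separating bond sets -/

section LowT

/-- Values of bond products. [folklore] -/
theorem spinAt_mul_spinAt_eq_neg_one_iff (x y : Site 2) (σ : SpinConfig (Site 2)) :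
    spinAt x σ * spinAt y σ = -1 ↔ σ x ≠ σ y := by
  rcases Int.units_eq_one_or (σ x) with hx | hx <;> rcases Int.units_eq_one_or (σ y) with hy | hy <;>
    simp [spinAt, hx, hy] <;> norm_num

/-- A bond product is `1` iff the two spins agree. [folklore] -/
theorem spinAt_mul_spinAt_eq_one_iff (x y : Site 2) (σ : SpinConfig (Site 2)) :
    spinAt x σ * spinAt y σ = 1 ↔ σ x = σ y := by
  rcases Int.units_eq_one_or (σ x) with hx | hx <;> rcases Int.units_eq_one_or (σ y) with hy | hy <;>
    simp [spinAt, hx, hy] <;> norm_num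

variable (c d : Site 2)

/-- **The corners of a face of `Q = [c,d]` are sites of `S = [c, d + (1,1)]`**: the face labelled
`f` (lower-left corner `f`) has corners `f + δ`, `δ ∈ {0,1}²`. [folklore] -/
theorem corner_mem_of_face_mem {f : Site 2} (hf : f ∈ Finset.Icc c d) {δ : Site 2}
    (hδ0 : 0 ≤ δ 0 ∧ δ 0 ≤ 1) (hδ1 : 0 ≤ δ 1 ∧ δ 1 ≤ 1) : f + δ ∈ Finset.Icc c (d + 1) := by
  rw [mem_Icc_site] at hf ⊢
  simp only [Pi.add_apply, Pi.one_apply]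
  omega

/-- Components of the unit vectors. [folklore] -/
theorem vec_apply_bounds (i j : Fin 2) : 0 ≤ vec i j ∧ vec i j ≤ 1 := by
  fin_cases i <;> fin_cases j <;> simp

/-- **A bond with an endpoint outside `S` separates two faces outside `Q`**: both faces of the
crossing dual bond have both endpoints of the bond as corners. [folklore] -/
theorem cross_faces_not_mem {ε : AEdge} (hε : ε.1 ∉ Finset.Icc c (d + 1) ∨ ε.tip ∉ Finset.Icc c (d + 1)) :
    (cross ε).1 ∉ Finset.Icc c d ∧ (cross ε).tip ∉ Finset.Icc c d := by
  have key : ∀ f : Site 2, f ∈ Finset.Icc c d → (∃ δ : Site 2, (0 ≤ δ 0 ∧ δ 0 ≤ 1) ∧ (0 ≤ δ 1 ∧ δ 1 ≤ 1) ∧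
      (f + δ = ε.1)) → (∃ δ : Site 2, (0 ≤ δ 0 ∧ δ 0 ≤ 1) ∧ (0 ≤ δ 1 ∧ δ 1 ≤ 1) ∧ (f + δ = ε.tip)) →
      False := by
    intro f hf ⟨δ, hδ0, hδ1, h1⟩ ⟨δ', hδ0', hδ1', h2⟩
    rcases hε with h | h
    · exact h (h1 ▸ corner_mem_of_face_mem c d hf hδ0 hδ1)
    · exact h (h2 ▸ corner_mem_of_face_mem c d hf hδ0' hδ1')
  constructor
  · intro hf
    refine key _ hf ⟨vec ε.2.rev, vec_apply_bounds _ 0, vec_apply_bounds _ 1, ?_⟩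
      ⟨1, by simp, by simp, ?_⟩
    · rw [cross_fst, sub_add_cancel]
    · have h1 := vec_add_vec_rev ε.2
      rw [cross_fst, tip, ← h1]; abel
  · intro hf
    refine key _ hf ⟨0, by simp, by simp, by rw [cross_tip, add_zero]⟩
      ⟨vec ε.2, vec_apply_bounds _ 0, vec_apply_bounds _ 1, by rw [cross_tip]; rfl⟩

/-- The **separating bond set** of a face configuration: the bonds of `S = [c, d+(1,1)]` whose two
adjacent faces carry opposite spins (BGJS App. a): "draw a unit segment perpendicular to the
center of each bond having opposite spins at its extremes", here recorded on the crossed bonds). [cite: BenettinGallavottiJonaLasinioStella1973, Appendix a), low-temperature expansion] -/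
def sepSet (ρ : SpinConfig (Site 2)) : Finset AEdge :=
  (anch (Finset.Icc c (d + 1))).filter fun ε => bE (cross ε) ρ = -1

variable {c d}

/-- Membership in the separating bond set. [folklore] -/
theorem mem_sepSet {ρ : SpinConfig (Site 2)} {ε : AEdge} :
    ε ∈ sepSet c d ρ ↔ ε ∈ anch (Finset.Icc c (d + 1)) ∧ bE (cross ε) ρ = -1 := Finset.mem_filter

/-- The separating bond set lies in `ℰ_S`. [folklore] -/
theorem sepSet_subset (ρ : SpinConfig (Site 2)) : sepSet c d ρ ⊆ anch (Finset.Icc c (d + 1)) :=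
  Finset.filter_subset _ _

/-- For a configuration equal to `+1` off `Q`, a bond with an endpoint outside `S` is never
separating, so membership in the separating set is decided by the bond product alone. [folklore] -/
theorem mem_sepSet_iff_of_plus {ρ : SpinConfig (Site 2)} (hρ : ∀ z ∉ Finset.Icc c d, ρ z = 1)
    (ε : AEdge) : ε ∈ sepSet c d ρ ↔ bE (cross ε) ρ = -1 := by
  rw [mem_sepSet]
  refine ⟨fun h => h.2, fun h => ⟨?_, h⟩⟩
  by_contra hn
  rw [mem_anch, not_and_or] at hn
  obtain ⟨h1, h2⟩ := cross_faces_not_mem c d hn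
  rw [bE, spinAt_mul_spinAt_eq_neg_one_iff] at h
  exact h (by rw [hρ _ h1, hρ _ h2])

/-- **The plaquette identity**: the four bond products around a site multiply to `1`, so an even
number of the four bonds at a site are separating (BGJS App. a): the separating segments form
"a closed multipolygon" for closed boundary conditions). [cite: BenettinGallavottiJonaLasinioStella1973, Appendix a), low-temperature expansion] -/
theorem even_card_sep_at (ρ : SpinConfig (Site 2)) (v : Site 2) :
    Even ((if bE (cross (v, 0)) ρ = -1 then 1 else 0) + (if bE (cross (v, 1)) ρ = -1 then 1 else 0) +
      (if bE (cross (v - vec 0, 0)) ρ = -1 then 1 else 0) +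
      (if bE (cross (v - vec 1, 1)) ρ = -1 then 1 else 0)) := by
  -- the four products
  have e1 : bE (cross (v, 0)) ρ = spinAt (v - vec 1) ρ * spinAt v ρ := by
    simp [bE, cross, tip]
  have e2 : bE (cross (v, 1)) ρ = spinAt (v - vec 0) ρ * spinAt v ρ := by
    simp [bE, cross, tip]
  have e3 : bE (cross (v - vec 0, 0)) ρ = spinAt (v - vec 0 - vec 1) ρ * spinAt (v - vec 0) ρ := by
    simp [bE, cross, tip]
  have e4 : bE (cross (v - vec 1, 1)) ρ = spinAt (v - vec 0 - vec 1) ρ * spinAt (v - vec 1) ρ := by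
    simp only [bE, cross, tip, rev_one, sub_add_cancel]
    rw [sub_right_comm]
  rw [e1, e2, e3, e4]
  have h1 := spinAt_eq_one_or_eq_neg_one v ρ
  have h2 := spinAt_eq_one_or_eq_neg_one (v - vec 0) ρ
  have h3 := spinAt_eq_one_or_eq_neg_one (v - vec 1) ρ
  have h4 := spinAt_eq_one_or_eq_neg_one (v - vec 0 - vec 1) ρ
  generalize spinAt v ρ = a at *
  generalize spinAt (v - vec 0) ρ = b at *
  generalize spinAt (v - vec 1) ρ = e at *
  generalize spinAt (v - vec 0 - vec 1) ρ = f at *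
  rcases h1 with rfl | rfl <;> rcases h2 with rfl | rfl <;> rcases h3 with rfl | rfl <;>
    rcases h4 with rfl | rfl <;> norm_num <;> decide

/-- The degree of a site in the separating set is the number of separating bonds among the four
bonds at the site. [folklore] -/
theorem adeg_sepSet_eq {ρ : SpinConfig (Site 2)} (hρ : ∀ z ∉ Finset.Icc c d, ρ z = 1) (v : Site 2) :
    adeg (sepSet c d ρ) v =
      (if bE (cross (v, 0)) ρ = -1 then 1 else 0) + (if bE (cross (v, 1)) ρ = -1 then 1 else 0) +
      (if bE (cross (v - vec 0, 0)) ρ = -1 then 1 else 0) +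
      (if bE (cross (v - vec 1, 1)) ρ = -1 then 1 else 0) := by
  classical
  rw [adeg]
  -- the bonds at `v` are exactly the four listed ones
  have hfour : ∀ ε : AEdge, (v = ε.1 ∨ v = ε.tip) ↔
      (ε = (v, 0) ∨ ε = (v, 1) ∨ ε = (v - vec 0, 0) ∨ ε = (v - vec 1, 1)) := by
    rintro ⟨u, i⟩
    simp only [tip, Prod.mk.injEq]
    constructor
    · rintro (rfl | rfl)
      · fin_cases i
        · exact Or.inl ⟨rfl, rfl⟩
        · exact Or.inr (Or.inl ⟨rfl, rfl⟩)
      · fin_cases i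
        · exact Or.inr (Or.inr (Or.inl ⟨by simp, rfl⟩))
        · exact Or.inr (Or.inr (Or.inr ⟨by simp, rfl⟩))
    · rintro (⟨rfl, rfl⟩ | ⟨rfl, rfl⟩ | ⟨rfl, rfl⟩ | ⟨rfl, rfl⟩)
      · exact Or.inl rfl
      · exact Or.inl rfl
      · exact Or.inr (by simp)
      · exact Or.inr (by simp)
  have hset : (sepSet c d ρ).filter (fun ε => v = ε.1 ∨ v = ε.tip) =
      ({(v, 0), (v, 1), (v - vec 0, 0), (v - vec 1, 1)} : Finset AEdge).filter
        (fun ε => bE (cross ε) ρ = -1) := by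
    ext ε
    simp only [Finset.mem_filter, mem_sepSet_iff_of_plus hρ, Finset.mem_insert, Finset.mem_singleton,
      hfour]
    tauto
  rw [hset]
  have hv0 : vec (0 : Fin 2) ≠ 0 := vec_ne_zero 0
  have hv1 : vec (1 : Fin 2) ≠ 0 := vec_ne_zero 1
  have d12 : ((v, 0) : AEdge) ≠ (v, 1) := by simp
  have d13 : ((v, 0) : AEdge) ≠ (v - vec 0, 0) := by
    simp only [ne_eq, Prod.mk.injEq, and_true]; intro h; exact hv0 (by simpa using h.symm)
  have d14 : ((v, 0) : AEdge) ≠ (v - vec 1, 1) := by simp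
  have d23 : ((v, 1) : AEdge) ≠ (v - vec 0, 0) := by simp
  have d24 : ((v, 1) : AEdge) ≠ (v - vec 1, 1) := by
    simp only [ne_eq, Prod.mk.injEq, and_true]; intro h; exact hv1 (by simpa using h.symm)
  have d34 : ((v - vec 0, 0) : AEdge) ≠ (v - vec 1, 1) := by simp
  rw [Finset.filter_insert, Finset.filter_insert, Finset.filter_insert, Finset.filter_singleton]
  split_ifs <;> simp [*, Finset.card_insert_of_notMem]

/-- **The separating bond set of a closed-boundary face configuration is even**: every site has
even degree (BGJS App. a): for closed boundary conditions the separating segments constitute "a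
closed multipolygon"). [cite: BenettinGallavottiJonaLasinioStella1973, Appendix a), low-temperature expansion] -/
theorem even_adeg_sepSet {ρ : SpinConfig (Site 2)} (hρ : ∀ z ∉ Finset.Icc c d, ρ z = 1) (v : Site 2) :
    Even (adeg (sepSet c d ρ) v) := by
  rw [adeg_sepSet_eq hρ]
  exact even_card_sep_at ρ v

/-- Two units of `ℤ` that agree on their comparison with a third unit are equal. [folklore] -/
theorem units_eq_of_iff {a b w : ℤˣ} (h : a = w ↔ b = w) : a = b := by
  rcases Int.units_eq_one_or a with rfl | rfl <;> rcases Int.units_eq_one_or b with rfl | rfl <;>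
    rcases Int.units_eq_one_or w with rfl | rfl <;> simp_all

/-- Glued plus configurations are `+1` off the volume. [folklore] -/
theorem glue_plus_apply_of_not_mem {Λ : Finset (Site 2)} (τ : ↥Λ → ℤˣ) {z : Site 2} (hz : z ∉ Λ) :
    glue Λ τ .plus z = 1 := by
  rw [glue_apply_of_notMem Λ τ _ hz]; rfl

/-! #### Injectivity: a configuration is recovered from its separating set column by column -/

/-- **The separating set determines the closed-boundary configuration** (the low-temperature map
of BGJS App. a) is one-to-one for closed boundary conditions: walking up a column from a face to
the `+` boundary, the spin flips exactly at the separating bonds). [cite: BenettinGallavottiJonaLasinioStella1973, Appendix a), low-temperature expansion] -/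
theorem glue_eq_of_sepSet_eq {τ τ' : ↥(Finset.Icc c d) → ℤˣ}
    (h : sepSet c d (glue (Finset.Icc c d) τ .plus) = sepSet c d (glue (Finset.Icc c d) τ' .plus)) :
    ∀ f ∈ Finset.Icc c d, glue (Finset.Icc c d) τ .plus f = glue (Finset.Icc c d) τ' .plus f := by
  set ρ := glue (Finset.Icc c d) τ .plus with hρdef
  set ρ' := glue (Finset.Icc c d) τ' .plus with hρ'def
  have hρ : ∀ z ∉ Finset.Icc c d, ρ z = 1 := fun z hz => glue_plus_apply_of_not_mem τ hz
  have hρ' : ∀ z ∉ Finset.Icc c d, ρ' z = 1 := fun z hz => glue_plus_apply_of_not_mem τ' hz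
  -- the bond between the faces `f` and `f + e₁`
  have step : ∀ f : Site 2, (ρ f = ρ (f + vec 1) ↔ ρ' f = ρ' (f + vec 1)) := by
    intro f
    have hmem : (uncross (f, 1) ∈ sepSet c d ρ) ↔ (uncross (f, 1) ∈ sepSet c d ρ') := by rw [h]
    rw [mem_sepSet_iff_of_plus hρ, mem_sepSet_iff_of_plus hρ', cross_uncross, bE, bE,
      spinAt_mul_spinAt_eq_neg_one_iff, spinAt_mul_spinAt_eq_neg_one_iff] at hmem
    change (ρ f ≠ ρ (f + vec 1)) ↔ (ρ' f ≠ ρ' (f + vec 1)) at hmem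
    tauto
  have main : ∀ n : ℕ, ∀ f ∈ Finset.Icc c d, (d 1 - f 1).toNat = n → ρ f = ρ' f := by
    intro n
    induction n with
    | zero =>
      intro f hf hn
      have htop : f + vec 1 ∉ Finset.Icc c d := by
        rw [mem_Icc_site] at hf ⊢
        simp only [Pi.add_apply, vec_one_apply_zero, vec_one_apply_one]
        omega
      have hs := step f
      rw [hρ _ htop, hρ' _ htop] at hs
      exact units_eq_of_iff hs
    | succ n ih =>
      intro f hf hn
      have hup : f + vec 1 ∈ Finset.Icc c d := by
        rw [mem_Icc_site] at hf ⊢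
        simp only [Pi.add_apply, vec_one_apply_zero, vec_one_apply_one]
        omega
      have hn' : (d 1 - (f + vec 1) 1).toNat = n := by
        simp only [Pi.add_apply, vec_one_apply_one]
        omega
      have ihf := ih _ hup hn'
      have hs := step f
      rw [ihf] at hs
      exact units_eq_of_iff hs
  intro f hf
  exact main _ f hf rfl

/-- The low-temperature map `τ ↦ (separating set of τ·+)` is injective. [cite: BenettinGallavottiJonaLasinioStella1973, Appendix a), low-temperature expansion] -/
theorem sepSet_glue_injective :
    Function.Injective fun τ : ↥(Finset.Icc c d) → ℤˣ => sepSet c d (glue (Finset.Icc c d) τ .plus) := by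
  intro τ τ' h
  funext z
  have hz := glue_eq_of_sepSet_eq h z z.2
  rwa [glue_apply_of_mem _ τ _ z.2, glue_apply_of_mem _ τ' _ z.2] at hz

/-! #### The even-cut lemma -/

/-- **An even bond set has an even cut**: if every site has even degree in `F`, the number of
bonds of `F` with exactly one endpoint in any finite set `T` is even (handshake). [folklore] -/
theorem even_card_cut {F : Finset AEdge} (hF : ∀ v, Even (adeg F v)) (T : Finset (Site 2)) :
    Even (#(F.filter fun ε => (ε.1 ∈ T ∧ ε.tip ∉ T) ∨ (ε.1 ∉ T ∧ ε.tip ∈ T))) := by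
  classical
  -- double counting of incidences between `T` and `F`
  have hdc : ∑ v ∈ T, adeg F v =
      ∑ ε ∈ F, ((if ε.1 ∈ T then 1 else 0) + (if ε.tip ∈ T then 1 else 0)) := by
    simp only [adeg, Finset.card_filter]
    rw [Finset.sum_comm]
    refine Finset.sum_congr rfl fun ε _ => ?_
    have h1 : ∑ v ∈ T, (if v = ε.1 ∨ v = ε.tip then 1 else 0) =
        ∑ v ∈ T, ((if v = ε.1 then 1 else 0) + (if v = ε.tip then 1 else 0)) := by
      refine Finset.sum_congr rfl fun v _ => ?_
      by_cases ha : v = ε.1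
      · have hb : v ≠ ε.tip := by rw [ha]; exact ε.fst_ne_tip
        simp [ha, ε.fst_ne_tip]
      · by_cases hb : v = ε.tip
        · simp [hb, ε.fst_ne_tip.symm]
        · simp [ha, hb]
    rw [h1, Finset.sum_add_distrib, Finset.sum_ite_eq' T ε.1, Finset.sum_ite_eq' T ε.tip]
  have hlhs : Even (∑ v ∈ T, adeg F v) := by
    rw [even_iff_two_dvd]
    exact Finset.dvd_sum fun v _ => even_iff_two_dvd.1 (hF v)
  rw [hdc] at hlhs
  have hsplit : ∑ ε ∈ F, ((if ε.1 ∈ T then 1 else 0) + (if ε.tip ∈ T then 1 else 0)) =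
      2 * #(F.filter fun ε => ε.1 ∈ T ∧ ε.tip ∈ T) +
        #(F.filter fun ε => (ε.1 ∈ T ∧ ε.tip ∉ T) ∨ (ε.1 ∉ T ∧ ε.tip ∈ T)) := by
    rw [Finset.card_filter, Finset.card_filter, Finset.mul_sum, ← Finset.sum_add_distrib]
    refine Finset.sum_congr rfl fun ε _ => ?_
    by_cases h1 : ε.1 ∈ T <;> by_cases h2 : ε.tip ∈ T <;> simp [h1, h2]
  rw [hsplit, Nat.even_add] at hlhs
  exact hlhs.1 (even_two_mul _)

/-! #### Surjectivity: the configuration with a prescribed even separating set -/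

/-- The number of bonds of `F` crossed by the upward ray from the face `z`: the horizontal bonds
`{(z₀, j), (z₀+1, j)}` with `j > z₁`. [folklore] -/
def above (F : Finset AEdge) (z : Site 2) : ℕ :=
  #(F.filter fun ε => ε.2 = 0 ∧ ε.1 0 = z 0 ∧ z 1 < ε.1 1)

/-- The face configuration with separating set `F`: `(-1)^{#crossings above}`. [folklore] -/
def cfgOf (F : Finset AEdge) : SpinConfig (Site 2) := fun z => if Even (above F z) then 1 else -1

/-- The constructed configuration is `+1` exactly where the crossing count is even. [folklore] -/
theorem cfgOf_apply_eq_one_iff (F : Finset AEdge) (z : Site 2) : cfgOf F z = 1 ↔ Even (above F z) := by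
  unfold cfgOf
  split_ifs with h
  · simp [h]
  · simp [h]

/-- The spin of the constructed configuration as a real number. [folklore] -/
theorem spinAt_cfgOf (F : Finset AEdge) (z : Site 2) :
    spinAt z (cfgOf F) = if Even (above F z) then 1 else -1 := by
  rw [spinAt]
  unfold cfgOf
  by_cases h : Even (above F z) <;> simp [h]

/-- The product of two spins of `cfgOf F` is `-1` iff the crossing counts have opposite parity. [folklore] -/
theorem bE_cfgOf_eq_neg_one_iff (F : Finset AEdge) (x y : Site 2) :
    spinAt x (cfgOf F) * spinAt y (cfgOf F) = -1 ↔ ¬(Even (above F x) ↔ Even (above F y)) := by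
  rw [spinAt_cfgOf, spinAt_cfgOf]
  by_cases hx : Even (above F x) <;> by_cases hy : Even (above F y) <;> simp [hx, hy] <;> norm_num

/-- Bonds of `ℰ_S`, `S = [c, d+(1,1)]`, in coordinates. [folklore] -/
theorem mem_anch_coords {ε : AEdge} (hε : ε ∈ anch (Finset.Icc c (d + 1))) :
    (c 0 ≤ ε.1 0 ∧ ε.1 0 + vec ε.2 0 ≤ d 0 + 1) ∧ (c 1 ≤ ε.1 1 ∧ ε.1 1 + vec ε.2 1 ≤ d 1 + 1) := by
  rw [mem_anch, mem_Icc_site, mem_Icc_site] at hε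
  simp only [tip_apply, Pi.add_apply, Pi.one_apply] at hε
  have h0 := vec_apply_bounds ε.2 0
  have h1 := vec_apply_bounds ε.2 1
  omega

/-- **Horizontal step of the crossing count**: the ray from the face `u − e₁` crosses, in
addition to the ray from `u`, exactly the bond `{u, u + e₀}` (if it belongs to `F`). [folklore] -/
theorem above_sub_vec_one (F : Finset AEdge) (u : Site 2) :
    above F (u - vec 1) = above F u + (if ((u, 0) : AEdge) ∈ F then 1 else 0) := by
  classical
  rw [above, above, Finset.card_filter, Finset.card_filter,
    ← Finset.sum_ite_eq' F ((u, 0) : AEdge) (fun _ => (1 : ℕ)), ← Finset.sum_add_distrib]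
  refine Finset.sum_congr rfl fun ε _ => ?_
  obtain ⟨w, i⟩ := ε
  simp only [Pi.sub_apply, vec_one_apply_zero, sub_zero, vec_one_apply_one]
  have hw : ((w, i) : AEdge) = (u, 0) ↔ (w 0 = u 0 ∧ w 1 = u 1) ∧ i = 0 := by
    rw [Prod.mk.injEq, funext_iff, Fin.forall_fin_two]
  by_cases hi : i = 0
  · subst hi
    by_cases h0 : w 0 = u 0
    · by_cases hlt : u 1 < w 1
      · have hne : ¬ (w 1 = u 1) := by omega
        simp [h0, hlt, hw, hne, show u 1 - 1 < w 1 by omega]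
      · by_cases heq : w 1 = u 1
        · simp [h0, hw, heq]
        · have : ¬ (u 1 - 1 < w 1) := by omega
          simp [h0, hlt, hw, heq, this]
    · simp [h0, hw]
  · simp [hi, hw]

/-- Bonds of an even bond set of `S` have even degree everywhere (off `S` the degree is `0`). [folklore] -/
theorem even_adeg_of_mem_bondSets {F : Finset AEdge} (hF : F ∈ bondSets (Finset.Icc c (d + 1)) ∅)
    (v : Site 2) : Even (adeg F v) := by
  rw [mem_bondSets] at hF
  by_cases hv : v ∈ Finset.Icc c (d + 1)
  · have h : v ∉ oddSet (Finset.Icc c (d + 1)) F := by rw [hF.2]; exact Finset.notMem_empty v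
    rw [mem_oddSet, not_and] at h
    exact Nat.not_odd_iff_even.1 (h hv)
  · have h0 : adeg F v = 0 := by
      rw [adeg, Finset.card_eq_zero, Finset.filter_eq_empty_iff]
      intro ε hε h
      have hε' := mem_anch.1 (hF.1 hε)
      rcases h with rfl | rfl
      · exact hv hε'.1
      · exact hv hε'.2
    rw [h0]; exact Even.zero

/-- **Vertical step of the crossing count** (even-cut lemma for the half column above `u`): the
rays from the faces `u − e₀` and `u` together with the bond `{u, u + e₁}` cross `F` an even number
of times. [folklore] -/
theorem even_above_vertical {F : Finset AEdge} (hFS : F ⊆ anch (Finset.Icc c (d + 1)))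
    (hF : ∀ v, Even (adeg F v)) (u : Site 2) :
    Even (above F (u - vec 0) + above F u + (if ((u, 1) : AEdge) ∈ F then 1 else 0)) := by
  classical
  set T : Finset (Site 2) := (Finset.Icc c (d + 1)).filter fun v => v 0 = u 0 ∧ u 1 < v 1 with hTdef
  have hT : ∀ v : Site 2, v ∈ T ↔ v ∈ Finset.Icc c (d + 1) ∧ (v 0 = u 0 ∧ u 1 < v 1) := fun v => by
    rw [hTdef, Finset.mem_filter]
  have hcut := even_card_cut hF T
  have hcount : #(F.filter fun ε => (ε.1 ∈ T ∧ ε.tip ∉ T) ∨ (ε.1 ∉ T ∧ ε.tip ∈ T)) =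
      above F (u - vec 0) + above F u + (if ((u, 1) : AEdge) ∈ F then 1 else 0) := by
    rw [above, above, Finset.card_filter, Finset.card_filter, Finset.card_filter,
      ← Finset.sum_ite_eq' F ((u, 1) : AEdge) (fun _ => (1 : ℕ)), ← Finset.sum_add_distrib,
      ← Finset.sum_add_distrib]
    refine Finset.sum_congr rfl fun ε hε => ?_
    have hε' := mem_anch.1 (hFS hε)
    obtain ⟨w, i⟩ := ε
    have hw1 : ((w, i) : AEdge) = (u, 1) ↔ (w 0 = u 0 ∧ w 1 = u 1) ∧ i = 1 := by
      rw [Prod.mk.injEq, funext_iff, Fin.forall_fin_two]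
    simp only [hT, hε'.1, hε'.2, true_and, tip_apply, Pi.sub_apply, vec_zero_apply_zero,
      vec_zero_apply_one, sub_zero, hw1]
    fin_cases i
    · simp only [vec_zero_apply_zero, vec_zero_apply_one, add_zero, Fin.zero_eta, true_and,
        show ((0 : Fin 2) = 1) = False from propext ⟨fun h => absurd h (by decide), False.elim⟩,
        and_false, if_false]
      split_ifs <;> omega
    · simp only [vec_one_apply_zero, vec_one_apply_one, add_zero, Fin.mk_one, and_true,
        show ((1 : Fin 2) = 0) = False from propext ⟨fun h => absurd h (by decide), False.elim⟩,
        false_and, if_false]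
      split_ifs <;> omega
  rwa [hcount] at hcut

/-- **Crossing counts vanish far from the rectangle**: left or right of `S`, or above it. [folklore] -/
theorem above_eq_zero_of_out {F : Finset AEdge} (hFS : F ⊆ anch (Finset.Icc c (d + 1))) {z : Site 2}
    (hz : z 0 < c 0 ∨ d 0 < z 0 ∨ d 1 < z 1) : above F z = 0 := by
  rw [above, Finset.card_eq_zero, Finset.filter_eq_empty_iff]
  rintro ⟨w, i⟩ hε ⟨hi, h0, h1⟩
  have hc := mem_anch_coords (hFS hε)
  simp only at hi h0 h1 hc
  subst hi
  simp only [vec_zero_apply_zero, vec_zero_apply_one] at hc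
  omega

/-- **Crossing counts below the rectangle are even** (even-cut lemma for the left part of `S`):
for a face `z` below `Q` in a column of `Q`, the whole column of horizontal bonds above it is cut,
an even number of which lie in `F`. [folklore] -/
theorem even_above_of_below {F : Finset AEdge} (hFS : F ⊆ anch (Finset.Icc c (d + 1)))
    (hF : ∀ v, Even (adeg F v)) {z : Site 2} (hz : z 1 < c 1) : Even (above F z) := by
  classical
  set T : Finset (Site 2) := (Finset.Icc c (d + 1)).filter fun v => v 0 ≤ z 0 with hTdef
  have hT : ∀ v : Site 2, v ∈ T ↔ v ∈ Finset.Icc c (d + 1) ∧ v 0 ≤ z 0 := fun v => by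
    rw [hTdef, Finset.mem_filter]
  have hcut := even_card_cut hF T
  have hcount : #(F.filter fun ε => (ε.1 ∈ T ∧ ε.tip ∉ T) ∨ (ε.1 ∉ T ∧ ε.tip ∈ T)) = above F z := by
    rw [above, Finset.card_filter, Finset.card_filter]
    refine Finset.sum_congr rfl fun ε hε => ?_
    have hε' := mem_anch.1 (hFS hε)
    have hc := mem_anch_coords (hFS hε)
    obtain ⟨w, i⟩ := ε
    simp only [hT, hε'.1, hε'.2, true_and, tip_apply]
    simp only at hc
    fin_cases i
    · simp only [vec_zero_apply_zero, vec_zero_apply_one, Fin.zero_eta, true_and] at hc ⊢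
      split_ifs <;> omega
    · simp only [vec_one_apply_zero, vec_one_apply_one, add_zero, Fin.mk_one,
        show ((1 : Fin 2) = 0) = False from propext ⟨fun h => absurd h (by decide), False.elim⟩,
        false_and, if_false] at hc ⊢
      split_ifs <;> omega
  rwa [hcount] at hcut

/-- **The constructed configuration is `+1` off `Q`.** [folklore] -/
theorem even_above_of_not_mem {F : Finset AEdge} (hF : F ∈ bondSets (Finset.Icc c (d + 1)) ∅)
    {z : Site 2} (hz : z ∉ Finset.Icc c d) : Even (above F z) := by
  have hFS := (mem_bondSets.1 hF).1
  by_cases h : z 0 < c 0 ∨ d 0 < z 0 ∨ d 1 < z 1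
  · rw [above_eq_zero_of_out hFS h]; exact Even.zero
  · have hz1 : z 1 < c 1 := by
      rw [mem_Icc_site] at hz
      omega
    exact even_above_of_below hFS (even_adeg_of_mem_bondSets hF) hz1

/-- The constructed configuration glued: `cfgOf F = (cfgOf F|_Q) · (+)`. [folklore] -/
theorem cfgOf_eq_glue {F : Finset AEdge} (hF : F ∈ bondSets (Finset.Icc c (d + 1)) ∅) :
    cfgOf F = glue (Finset.Icc c d) (fun z : ↥(Finset.Icc c d) => cfgOf F z) .plus := by
  funext z
  by_cases hz : z ∈ Finset.Icc c d
  · rw [glue_apply_of_mem _ _ _ hz]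
  · rw [glue_plus_apply_of_not_mem _ hz, cfgOf_apply_eq_one_iff]
    exact even_above_of_not_mem hF hz

/-- **The separating set of the constructed configuration is the prescribed even set** (the
low-temperature map is onto the closed multipolygons, BGJS App. b): "the `γ`'s of the high
temperature expansion for `Λ` coincide with the `λ`'s of the low temperature expansion for `Λ*`,
and vice versa"). [cite: BenettinGallavottiJonaLasinioStella1973, Appendix b)] -/
theorem sepSet_cfgOf {F : Finset AEdge} (hF : F ∈ bondSets (Finset.Icc c (d + 1)) ∅) :
    sepSet c d (cfgOf F) = F := by
  classical
  have hFS := (mem_bondSets.1 hF).1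
  have heven := even_adeg_of_mem_bondSets hF
  -- the bond product across the crossing bond detects membership in `F`
  have core : ∀ ε : AEdge, bE (cross ε) (cfgOf F) = -1 ↔ ε ∈ F := by
    rintro ⟨u, i⟩
    rw [bE, cross_tip, cross_fst, bE_cfgOf_eq_neg_one_iff]
    fin_cases i
    · simp only [Fin.zero_eta, rev_zero]
      rw [above_sub_vec_one]
      by_cases h : ((u, 0) : AEdge) ∈ F
      · simp only [h, if_true, iff_true]
        rw [Nat.even_add_one]
        tauto
      · simp [h]
    · simp only [Fin.mk_one, rev_one]
      have hv := even_above_vertical hFS heven u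
      rw [Nat.even_add, Nat.even_add] at hv
      by_cases h : ((u, 1) : AEdge) ∈ F
      · simp only [h, if_true, Nat.not_even_one, iff_false, iff_true] at hv ⊢
        exact hv
      · have h0 : Even (0 : ℕ) := ⟨0, rfl⟩
        simp only [h, if_false, h0, iff_true, iff_false, not_not] at hv ⊢
        exact hv
  ext ε
  rw [mem_sepSet, core]
  exact ⟨fun h => h.2, fun h => ⟨hFS h, h⟩⟩

/-- **The low-temperature map is a bijection onto the closed multipolygons** (BGJS App. a)–b)):
`τ ↦ sepSet(τ·+)` maps the configurations of the closed rectangle of faces `Q = [c,d]` bijectively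
onto the even bond sets of the rectangle of sites `S = [c, d+(1,1)]`. Here: the surjectivity. [cite: BenettinGallavottiJonaLasinioStella1973, Appendix a)–b)] -/
theorem sepSet_glue_surjOn :
    Set.SurjOn (fun τ : ↥(Finset.Icc c d) → ℤˣ => sepSet c d (glue (Finset.Icc c d) τ .plus))
      Set.univ ↑(bondSets (Finset.Icc c (d + 1)) ∅) := by
  intro F hF
  refine ⟨fun z => cfgOf F z, Set.mem_univ _, ?_⟩
  change sepSet c d (glue (Finset.Icc c d) (fun z : ↥(Finset.Icc c d) => cfgOf F z) .plus) = F
  rw [← cfgOf_eq_glue hF, sepSet_cfgOf hF]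

/-- The separating set of a closed-boundary configuration is a closed multipolygon: it lies in
`{F ⊆ ℰ_S : ∂F = ∅}`. [cite: BenettinGallavottiJonaLasinioStella1973, Appendix a)] -/
theorem sepSet_glue_mem_bondSets (τ : ↥(Finset.Icc c d) → ℤˣ) :
    sepSet c d (glue (Finset.Icc c d) τ .plus) ∈ bondSets (Finset.Icc c (d + 1)) ∅ := by
  rw [mem_bondSets]
  refine ⟨sepSet_subset _, ?_⟩
  ext v
  simp only [mem_oddSet, Finset.notMem_empty, iff_false, not_and]
  intro _
  rw [Nat.not_odd_iff_even]
  exact even_adeg_sepSet (fun z hz => glue_plus_apply_of_not_mem τ hz) v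

/-- **Summation over closed-boundary configurations = summation over closed multipolygons** (the
change of variables of the low-temperature expansion, BGJS (A.4)). [cite: BenettinGallavottiJonaLasinioStella1973, Appendix a), eq. (A.4)] -/
theorem sum_cfg_eq_sum_bondSets (φ : Finset AEdge → ℝ) :
    ∑ τ : ↥(Finset.Icc c d) → ℤˣ, φ (sepSet c d (glue (Finset.Icc c d) τ .plus)) =
      ∑ F ∈ bondSets (Finset.Icc c (d + 1)) ∅, φ F := by
  refine Finset.sum_nbij (fun τ => sepSet c d (glue (Finset.Icc c d) τ .plus)) (fun τ _ =>
    sepSet_glue_mem_bondSets τ) ?_ ?_ (fun _ _ => rfl)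
  · exact fun τ _ τ' _ h => sepSet_glue_injective h
  · simpa using sepSet_glue_surjOn (c := c) (d := d)

/-! #### The closed-boundary Boltzmann weight as a polygon weight (BGJS (A.4)) -/

/-- A dual bond touching `Q` is the crossing bond of a bond of `S`. [folklore] -/
theorem uncross_mem_anch_of_mem_anchT {δ : AEdge} (hδ : δ ∈ anchT (Finset.Icc c d)) :
    uncross δ ∈ anch (Finset.Icc c (d + 1)) := by
  rw [mem_anchT] at hδ
  rw [mem_anch, uncross_fst, uncross_tip]
  rcases hδ with h | h
  · refine ⟨?_, corner_mem_of_face_mem c d h (by simp) (by simp)⟩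
    exact corner_mem_of_face_mem c d h (vec_apply_bounds δ.2 0) (vec_apply_bounds δ.2 1)
  · refine ⟨by simpa using corner_mem_of_face_mem c d h (δ := 0) (by simp) (by simp), ?_⟩
    have h1 : δ.1 + 1 = δ.tip + vec δ.2.rev := by
      rw [tip, add_assoc, vec_add_vec_rev]
    rw [h1]
    exact corner_mem_of_face_mem c d h (vec_apply_bounds _ 0) (vec_apply_bounds _ 1)

/-- **The closed-boundary energy in terms of the bonds of `S`**: `-H⁺_{Q;0}(ρ) = ∑_{b ∈ ℰ_S} σ_{b×}(ρ) − c₀`,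
where `c₀` counts the bonds of `S` both of whose adjacent faces lie outside `Q` (a constant). [cite: BenettinGallavottiJonaLasinioStella1973, Appendix a), eq. (A.4)] -/
theorem neg_isingHamiltonian_plus_faces (τ : ↥(Finset.Icc c d) → ℤˣ) :
    -isingHamiltonian (zdGraph 2) (Finset.Icc c d) 0 .plus (glue (Finset.Icc c d) τ .plus) =
      ∑ ε ∈ anch (Finset.Icc c (d + 1)), bE (cross ε) (glue (Finset.Icc c d) τ .plus) -
        #((anch (Finset.Icc c (d + 1))).filter fun ε => cross ε ∉ anchT (Finset.Icc c d)) := by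
  classical
  set ρ := glue (Finset.Icc c d) τ .plus with hρdef
  have hρ : ∀ z ∉ Finset.Icc c d, ρ z = 1 := fun z hz => glue_plus_apply_of_not_mem τ hz
  simp only [isingHamiltonian, BoundaryCondition.plus, interactionEdges_fixed, zero_mul, sub_zero,
    neg_neg]
  rw [sum_edgesTouching_eq_sum_anchT]
  simp only [bondSpin_toSym2]
  -- reindex the dual bonds touching `Q` by the bonds of `S` they cross
  have hre : ∑ δ ∈ anchT (Finset.Icc c d), bE δ ρ =
      ∑ ε ∈ (anch (Finset.Icc c (d + 1))).filter (fun ε => cross ε ∈ anchT (Finset.Icc c d)),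
        bE (cross ε) ρ := by
    refine Finset.sum_nbij' uncross cross (fun δ hδ => ?_) (fun ε hε => (Finset.mem_filter.1 hε).2)
      (fun δ _ => cross_uncross δ) (fun ε _ => uncross_cross ε) (fun δ _ => by rw [cross_uncross])
    exact Finset.mem_filter.2 ⟨uncross_mem_anch_of_mem_anchT hδ, by rw [cross_uncross]; exact hδ⟩
  rw [hre, ← Finset.sum_filter_add_sum_filter_not (anch (Finset.Icc c (d + 1)))
    (fun ε => cross ε ∈ anchT (Finset.Icc c d)) (fun ε => bE (cross ε) ρ)]
  have hones : ∑ ε ∈ (anch (Finset.Icc c (d + 1))).filter (fun ε => cross ε ∉ anchT (Finset.Icc c d)),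
      bE (cross ε) ρ = #((anch (Finset.Icc c (d + 1))).filter fun ε => cross ε ∉ anchT (Finset.Icc c d)) := by
    rw [Finset.card_eq_sum_ones, Nat.cast_sum, Nat.cast_one]
    refine Finset.sum_congr rfl fun ε hε => ?_
    rw [Finset.mem_filter, mem_anchT, not_or] at hε
    rw [bE, spinAt_mul_spinAt_eq_one_iff, hρ _ hε.2.1, hρ _ hε.2.2]
  rw [hones]
  ring

/-- The sum of the crossing bond products counts the separating bonds:
`∑_{b ∈ ℰ_S} σ_{b×} = |ℰ_S| − 2 |sep|`. [folklore] -/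
theorem sum_bE_cross_eq (ρ : SpinConfig (Site 2)) :
    ∑ ε ∈ anch (Finset.Icc c (d + 1)), bE (cross ε) ρ =
      #(anch (Finset.Icc c (d + 1))) - 2 * #(sepSet c d ρ) := by
  classical
  have h1 : ∀ ε ∈ anch (Finset.Icc c (d + 1)), bE (cross ε) ρ =
      1 - 2 * (if bE (cross ε) ρ = -1 then 1 else 0) := by
    intro ε _
    rcases bE_eq_one_or (cross ε) ρ with h | h <;> rw [h] <;> norm_num
  rw [Finset.sum_congr rfl h1, Finset.sum_sub_distrib, Finset.sum_const, nsmul_eq_mul, mul_one,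
    ← Finset.mul_sum, sepSet, Finset.card_filter, Nat.cast_sum]
  congr 2
  refine Finset.sum_congr rfl fun ε _ => ?_
  split_ifs <;> simp

/-- **The closed-boundary Boltzmann weight is a polygon weight** (BGJS (A.4): `Z = e^{∑K} ∑_λ
∏_{b∈λ} e^{-2K_b}`): `w⁺_{Q;β',0}(τ) = C · (e^{-2β'})^{|sep(τ·+)|}` with
`C = exp(β'(|ℰ_S| − c₀)) > 0` independent of `τ`. [cite: BenettinGallavottiJonaLasinioStella1973, Appendix a), eq. (A.4)] -/
theorem isingWeight_plus_faces_eq (β' : ℝ) (τ : ↥(Finset.Icc c d) → ℤˣ) :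
    isingWeight (zdGraph 2) (Finset.Icc c d) β' 0 .plus τ =
      Real.exp (β' * (#(anch (Finset.Icc c (d + 1))) -
        #((anch (Finset.Icc c (d + 1))).filter fun ε => cross ε ∉ anchT (Finset.Icc c d)))) *
        Real.exp (-2 * β') ^ #(sepSet c d (glue (Finset.Icc c d) τ .plus)) := by
  rw [isingWeight, show -β' * isingHamiltonian (zdGraph 2) (Finset.Icc c d) 0 .plus
      (glue (Finset.Icc c d) τ .plus) = β' * -isingHamiltonian (zdGraph 2) (Finset.Icc c d) 0 .plus
      (glue (Finset.Icc c d) τ .plus) by ring, neg_isingHamiltonian_plus_faces, sum_bE_cross_eq,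
    ← Real.exp_nat_mul, ← Real.exp_add]
  congr 1
  ring

/-- **The closed-boundary expectation of the disorder observable as a polygon ratio** (BGJS (A.4)
with (A.8)–(A.10): the disorder factor is `e^{+2β'}` on separating bonds of `Γ` and `e^{-2β'}` on
the others): for `P ⊆ ℰ_S`, with `v = e^{-2β'}`,
`⟨∏_{b∈P}(cosh 2β' − σ_{b×} sinh 2β')⟩⁺_{Q;β',0} = ∑_{∂F=∅} v^{|F ∆ P|} / ∑_{∂F=∅} v^{|F|}`. [cite: BenettinGallavottiJonaLasinioStella1973, Appendix c), eq. (A.10)] -/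
theorem isingExpect_plus_faces_disorder_eq_ratio (β' : ℝ) {P : Finset AEdge}
    (hP : P ⊆ anch (Finset.Icc c (d + 1))) :
    isingExpect (zdGraph 2) (Finset.Icc c d) β' 0 .plus
        (fun ρ => ∏ ε ∈ P, (Real.cosh (2 * β') - Real.sinh (2 * β') * bE (cross ε) ρ)) =
      (∑ F ∈ bondSets (Finset.Icc c (d + 1)) ∅, Real.exp (-2 * β') ^ #(F ∆ P)) /
        ∑ F ∈ bondSets (Finset.Icc c (d + 1)) ∅, Real.exp (-2 * β') ^ #F := by
  classical
  set v : ℝ := Real.exp (-2 * β') with hv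
  have hv0 : 0 < v := Real.exp_pos _
  set C : ℝ := Real.exp (β' * (#(anch (Finset.Icc c (d + 1))) -
    #((anch (Finset.Icc c (d + 1))).filter fun ε => cross ε ∉ anchT (Finset.Icc c d)))) with hC
  have hC0 : 0 < C := Real.exp_pos _
  have hmeas : Measurable fun ρ : SpinConfig (Site 2) =>
      ∏ ε ∈ P, (Real.cosh (2 * β') - Real.sinh (2 * β') * bE (cross ε) ρ) :=
    Finset.measurable_prod _ fun ε _ =>
      measurable_const.sub (measurable_const.mul ((measurable_spinAt _).mul (measurable_spinAt _)))
  rw [isingExpect_eq_sum_div (zdGraph 2) _ 0 .plus β' hmeas, isingPartitionFunction]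
  -- the observable on a glued configuration, in terms of its separating set
  have hobs : ∀ τ : ↥(Finset.Icc c d) → ℤˣ,
      ∏ ε ∈ P, (Real.cosh (2 * β') - Real.sinh (2 * β') * bE (cross ε) (glue (Finset.Icc c d) τ .plus)) =
        v ^ #(P.filter fun ε => ε ∉ sepSet c d (glue (Finset.Icc c d) τ .plus)) *
          v⁻¹ ^ #(P.filter fun ε => ε ∈ sepSet c d (glue (Finset.Icc c d) τ .plus)) := by
    intro τ
    set D := sepSet c d (glue (Finset.Icc c d) τ .plus) with hD
    have h1 : ∀ ε ∈ P, Real.cosh (2 * β') - Real.sinh (2 * β') * bE (cross ε) (glue (Finset.Icc c d) τ .plus) =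
        if ε ∈ D then v⁻¹ else v := by
      intro ε hε
      have hmem : ε ∈ D ↔ bE (cross ε) (glue (Finset.Icc c d) τ .plus) = -1 := by
        rw [hD, mem_sepSet]; exact ⟨fun h => h.2, fun h => ⟨hP hε, h⟩⟩
      by_cases h : ε ∈ D
      · rw [if_pos h, hmem.1 h, hv, show (-2 : ℝ) * β' = -(2 * β') by ring, Real.exp_neg, inv_inv,
          mul_neg_one, sub_neg_eq_add, Real.cosh_add_sinh]
      · have h' : bE (cross ε) (glue (Finset.Icc c d) τ .plus) = 1 := by
          rcases bE_eq_one_or (cross ε) (glue (Finset.Icc c d) τ .plus) with h'' | h''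
          · exact h''
          · exact absurd (hmem.2 h'') h
        rw [if_neg h, h', mul_one, Real.cosh_sub_sinh, hv]
        congr 1; ring
    rw [Finset.prod_congr rfl h1, Finset.prod_ite, Finset.prod_const, Finset.prod_const, mul_comm]
  -- exponent bookkeeping: `|F| + |P ∖ F| = |F ∆ P| + |P ∩ F|`
  have hcard : ∀ F : Finset AEdge, #F + #(P.filter fun ε => ε ∉ F) = #(F ∆ P) + #(P.filter fun ε => ε ∈ F) := by
    intro F
    have e1 : P.filter (fun ε => ε ∉ F) = P \ F := by ext ε; simp [Finset.mem_sdiff]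
    have e2 : P.filter (fun ε => ε ∈ F) = P ∩ F := Finset.filter_mem_eq_inter
    have e3 : #(F ∆ P) = #(F \ P) + #(P \ F) := by
      rw [symmDiff_def, Finset.sup_eq_union, Finset.card_union_of_disjoint disjoint_sdiff_sdiff]
    have e4 := Finset.card_sdiff_add_card_inter F P
    rw [e1, e2, e3, Finset.inter_comm]
    omega
  have hnum : ∀ τ : ↥(Finset.Icc c d) → ℤˣ,
      isingWeight (zdGraph 2) (Finset.Icc c d) β' 0 .plus τ *
        ∏ ε ∈ P, (Real.cosh (2 * β') - Real.sinh (2 * β') * bE (cross ε) (glue (Finset.Icc c d) τ .plus)) =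
        C * v ^ #(sepSet c d (glue (Finset.Icc c d) τ .plus) ∆ P) := by
    intro τ
    rw [hobs τ, isingWeight_plus_faces_eq, ← hC, ← hv, mul_assoc]
    congr 1
    set D := sepSet c d (glue (Finset.Icc c d) τ .plus)
    have h := hcard D
    have hvne : v ≠ 0 := hv0.ne'
    calc v ^ #D * (v ^ #(P.filter fun ε => ε ∉ D) * v⁻¹ ^ #(P.filter fun ε => ε ∈ D))
        = v ^ (#D + #(P.filter fun ε => ε ∉ D)) * v⁻¹ ^ #(P.filter fun ε => ε ∈ D) := by rw [pow_add]; ring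
      _ = v ^ (#(D ∆ P) + #(P.filter fun ε => ε ∈ D)) * v⁻¹ ^ #(P.filter fun ε => ε ∈ D) := by rw [h]
      _ = v ^ #(D ∆ P) := by
          rw [pow_add, inv_pow, mul_assoc, mul_inv_cancel₀ (pow_ne_zero _ hvne), mul_one]
  have hden : ∀ τ : ↥(Finset.Icc c d) → ℤˣ, isingWeight (zdGraph 2) (Finset.Icc c d) β' 0 .plus τ =
      C * v ^ #(sepSet c d (glue (Finset.Icc c d) τ .plus)) := fun τ => by
    rw [isingWeight_plus_faces_eq, ← hC, ← hv]
  rw [Finset.sum_congr rfl fun τ _ => hnum τ, Finset.sum_congr rfl fun τ _ => hden τ]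
  simp only [← Finset.mul_sum]
  rw [sum_cfg_eq_sum_bondSets (fun D => v ^ #(D ∆ P)), sum_cfg_eq_sum_bondSets (fun D => v ^ #D),
    mul_div_mul_left _ _ hC0.ne']

end LowT

/-! ### The symmetric-difference shift by the path (BGJS App. c), path independence (A.8)) -/

section Shift

/-- Degrees are additive modulo `2` under symmetric difference. [folklore] -/
theorem odd_adeg_symmDiff_iff (F P : Finset AEdge) (v : Site 2) :
    Odd (adeg (F ∆ P) v) ↔ ¬(Odd (adeg F v) ↔ Odd (adeg P v)) := by
  have hfilter : (F ∆ P).filter (fun ε => v = ε.1 ∨ v = ε.tip) =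
      F.filter (fun ε => v = ε.1 ∨ v = ε.tip) ∆ P.filter (fun ε => v = ε.1 ∨ v = ε.tip) := by
    ext ε
    simp only [Finset.mem_filter, Finset.mem_symmDiff]
    tauto
  rw [adeg, adeg, adeg, hfilter]
  set X := F.filter (fun ε => v = ε.1 ∨ v = ε.tip)
  set Y := P.filter (fun ε => v = ε.1 ∨ v = ε.tip)
  have h : #(X ∆ Y) + 2 * #(X ∩ Y) = #X + #Y := by
    have e3 : #(X ∆ Y) = #(X \ Y) + #(Y \ X) := by
      rw [symmDiff_def, Finset.sup_eq_union, Finset.card_union_of_disjoint disjoint_sdiff_sdiff]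
    have e4 := Finset.card_sdiff_add_card_inter X Y
    have e5 := Finset.card_sdiff_add_card_inter Y X
    rw [Finset.inter_comm] at e5
    omega
  have hpar : Odd #(X ∆ Y) ↔ Odd (#X + #Y) := by
    rw [← h, Nat.odd_add]
    simp
  rw [hpar, Nat.odd_add]
  rw [← Nat.not_odd_iff_even]
  tauto

/-- `∂(F ∆ P) = ∂F ∆ ∂P`. [folklore] -/
theorem oddSet_symmDiff (Λ : Finset (Site 2)) (F P : Finset AEdge) :
    oddSet Λ (F ∆ P) = oddSet Λ F ∆ oddSet Λ P := by
  ext v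
  simp only [mem_oddSet, Finset.mem_symmDiff, odd_adeg_symmDiff_iff]
  tauto

/-- **The shift by a path** (BGJS App. c), eq. (A.8): changing `K_b → K_b + iπ/2` on the bonds of
a path `Γ` from `x` to `y` turns the closed polygons into the polygons with sources `{x, y}` and
vice versa; combinatorially `F ↦ F ∆ Γ`): for `P ⊆ ℰ_Λ` with `∂P = B`,
`∑_{∂F = B} t^{|F|} = ∑_{∂F = ∅} t^{|F ∆ P|}`. [cite: BenettinGallavottiJonaLasinioStella1973, Appendix c), eq. (A.8)] -/
theorem sum_bondSets_shift (Λ : Finset (Site 2)) {P : Finset AEdge} (hP : P ⊆ anch Λ)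
    {B : Finset (Site 2)} (hPB : oddSet Λ P = B) (t : ℝ) :
    ∑ F ∈ bondSets Λ B, t ^ #F = ∑ F ∈ bondSets Λ ∅, t ^ #(F ∆ P) := by
  have hcancel : ∀ F : Finset AEdge, F ∆ P ∆ P = F := fun F => by
    rw [symmDiff_assoc, symmDiff_self, symmDiff_bot]
  refine Finset.sum_nbij' (fun F => F ∆ P) (fun F => F ∆ P) (fun F hF => ?_) (fun F hF => ?_)
    (fun F _ => hcancel F) (fun F _ => hcancel F) (fun F _ => by rw [hcancel])
  · rw [mem_bondSets] at hF ⊢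
    refine ⟨fun ε hε => ?_, ?_⟩
    · rcases Finset.mem_symmDiff.1 hε with h | h
      · exact hF.1 h.1
      · exact hP h.1
    · rw [oddSet_symmDiff, hF.2, hPB, symmDiff_self]; rfl
  · rw [mem_bondSets] at hF ⊢
    refine ⟨fun ε hε => ?_, ?_⟩
    · rcases Finset.mem_symmDiff.1 hε with h | h
      · exact hF.1 h.1
      · exact hP h.1
    · rw [oddSet_symmDiff, hF.2, hPB]; simp

end Shift

/-! ### Lattice paths as anchored bond sets -/

section Path

/-- The **anchored bond set of a lattice path** inside `Λ`. [folklore] -/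
def pathSet (Λ : Finset (Site 2)) {x y : Site 2} (p : (zdGraph 2).Walk x y) : Finset AEdge :=
  (anch Λ).filter fun ε => toSym2 ε ∈ p.edges

/-- The anchored bond set of a path inside `Λ` lies in `ℰ_Λ`. [folklore] -/
theorem pathSet_subset (Λ : Finset (Site 2)) {x y : Site 2} (p : (zdGraph 2).Walk x y) :
    pathSet Λ p ⊆ anch Λ := Finset.filter_subset _ _

/-- The bonds of a path inside `Λ` are the images of its anchored bond set. [folklore] -/
theorem edges_toFinset_eq {Λ : Finset (Site 2)} {x y : Site 2} (p : (zdGraph 2).Walk x y)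
    (hsupp : ∀ z ∈ p.support, z ∈ Λ) : p.edges.toFinset = (pathSet Λ p).image toSym2 := by
  classical
  ext e
  rw [List.mem_toFinset, Finset.mem_image]
  constructor
  · intro he
    have hin : e ∈ edgesIn (zdGraph 2) Λ := by
      rw [mem_edgesIn_iff]
      refine ⟨p.edges_subset_edgeSet he, fun z hz => ?_⟩
      induction e using Sym2.ind with
      | _ a b =>
        rcases Sym2.mem_iff.1 hz with rfl | rfl
        · exact hsupp _ (p.fst_mem_support_of_mem_edges he)
        · exact hsupp _ (p.snd_mem_support_of_mem_edges he)
    rw [edgesIn_eq_image_anch, Finset.mem_image] at hin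
    obtain ⟨ε, hε, rfl⟩ := hin
    exact ⟨ε, Finset.mem_filter.2 ⟨hε, he⟩, rfl⟩
  · rintro ⟨ε, hε, rfl⟩
    exact (Finset.mem_filter.1 hε).2

/-- **The disorder observable of a path as a product over its anchored bonds.** [cite: BenettinGallavottiJonaLasinioStella1973, eqs. (2.3)–(2.4)] -/
theorem kwDisorder_eq_prod_pathSet {Λ : Finset (Site 2)} {x y : Site 2} (p : (zdGraph 2).Walk x y)
    (hp : p.IsPath) (hsupp : ∀ z ∈ p.support, z ∈ Λ) (β' : ℝ) (σ : SpinConfig (Site 2)) :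
    kwDisorder β' p.edges σ =
      ∏ ε ∈ pathSet Λ p, (Real.cosh (2 * β') - Real.sinh (2 * β') * bE (cross ε) σ) := by
  classical
  rw [kwDisorder, ← List.prod_toFinset _ hp.isTrail.edges_nodup, edges_toFinset_eq p hsupp,
    Finset.prod_image fun ε _ ε' _ h => toSym2_injective h]
  refine Finset.prod_congr rfl fun ε _ => ?_
  rw [spinProduct_dualPair_toSym2]
  ring

/-- The degree of a site in the anchored bond set of a path is the number of bonds of the path
through it. [folklore] -/
theorem adeg_pathSet_eq_countP {Λ : Finset (Site 2)} {x y : Site 2} (p : (zdGraph 2).Walk x y)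
    (hp : p.IsPath) (hsupp : ∀ z ∈ p.support, z ∈ Λ) (v : Site 2) :
    adeg (pathSet Λ p) v = p.edges.countP fun e => v ∈ e := by
  classical
  rw [adeg, List.countP_eq_length_filter, ← List.toFinset_card_of_nodup (hp.isTrail.edges_nodup.filter _),
    List.toFinset_filter, edges_toFinset_eq p hsupp, Finset.filter_image,
    Finset.card_image_of_injective _ toSym2_injective]
  congr 1
  ext ε
  simp only [Finset.mem_filter, toSym2, Sym2.mem_iff, decide_eq_true_eq]

/-- **The sources of a path are its endpoints**: `∂Γ = {x, y}` for a path `Γ` from `x` to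
`y ≠ x` inside `Λ`. [cite: BenettinGallavottiJonaLasinioStella1973, Appendix c)] -/
theorem oddSet_pathSet {Λ : Finset (Site 2)} {x y : Site 2} (p : (zdGraph 2).Walk x y)
    (hp : p.IsPath) (hsupp : ∀ z ∈ p.support, z ∈ Λ) (hxy : x ≠ y) :
    oddSet Λ (pathSet Λ p) = {x, y} := by
  classical
  ext v
  rw [mem_oddSet, adeg_pathSet_eq_countP p hp hsupp, Finset.mem_insert, Finset.mem_singleton,
    ← Nat.not_even_iff_odd, hp.isTrail.even_countP_edges_iff]
  constructor
  · rintro ⟨-, h⟩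
    by_contra hv
    push Not at hv
    exact h fun _ => hv
  · intro h
    refine ⟨?_, fun h' => ?_⟩
    · rcases h with rfl | rfl
      · exact hsupp _ p.start_mem_support
      · exact hsupp _ p.end_mem_support
    · obtain ⟨h1, h2⟩ := h' hxy
      rcases h with rfl | rfl
      · exact h1 rfl
      · exact h2 rfl

end Path

/-! ### BGJS (A.10), open → closed -/

/-- **Discharge of `kw_free_plus_finite`** (BGJS, CMP 30 (1973), Appendix, eq. (A.10), open →
closed): for `β > 0`, a rectangle `R = [a,b]`, `x, y ∈ R` and a lattice path `Γ` from `x` to `y`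
inside `R`, `⟨σ_xσ_y⟩^∅_{R;β,0} = ⟨∏_{b∈Γ}(cosh 2β* − σ_{b*} sinh 2β*)⟩⁺_{R*;β*,0}` with `R* = [a, b−(1,1)]`
the rectangle of faces and `e^{-2β*} = tanh β`. Proof: both sides equal
`∑_{∂F=∅} t^{|F ∆ Γ|} / ∑_{∂F=∅} t^{|F|}` over the closed polygons `F ⊆ ℰ_R`, `t = tanh β = e^{-2β*}`
— the left by the high-temperature expansion and the shift by `Γ`, the right by the
low-temperature expansion (the bijection configuration ↔ separating polygon) and the values
`e^{∓2β*}` of the disorder factors. [cite: BenettinGallavottiJonaLasinioStella1973, Appendix, eq. (A.10)] -/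
theorem kw_free_plus_finite_holds : kw_free_plus_finite := by
  intro β hβ a b x y p hp hsupp
  classical
  by_cases hxy : x = y
  · subst hxy
    have hnil : p = SimpleGraph.Walk.nil :=
      SimpleGraph.Walk.eq_nil_iff_nil.2 (SimpleGraph.Walk.isPath_iff_nil.1 hp)
    subst hnil
    have h1 : kwDisorder (dualBeta β) (SimpleGraph.Walk.nil : (zdGraph 2).Walk x x).edges =
        fun _ => (1 : ℝ) := funext fun σ => by simp
    rw [isingTwoPoint_self, h1, isingExpect_const]
  · set R := Finset.Icc a b with hR
    have hPsub : pathSet R p ⊆ anch R := pathSet_subset R p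
    have hodd : oddSet R (pathSet R p) = {x, y} := oddSet_pathSet p hp hsupp hxy
    have hxR : x ∈ R := hsupp _ p.start_mem_support
    have hyR : y ∈ R := hsupp _ p.end_mem_support
    -- the open side: high-temperature expansion and the shift by the path
    rw [isingTwoPoint_eq_isingCorr _ _ _ _ _ hxy,
      isingCorr_free_eq_ratio R β (Finset.insert_subset_iff.2 ⟨hxR, Finset.singleton_subset_iff.2 hyR⟩),
      sum_bondSets_shift R hPsub hodd]
    -- the closed side: low-temperature expansion on the faces
    have hobs : kwDisorder (dualBeta β) p.edges = fun σ => ∏ ε ∈ pathSet R p,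
        (Real.cosh (2 * dualBeta β) - Real.sinh (2 * dualBeta β) * bE (cross ε) σ) :=
      funext (kwDisorder_eq_prod_pathSet p hp hsupp _)
    rw [hobs]
    have hPsub' : pathSet R p ⊆ anch (Finset.Icc a (b - 1 + 1)) := by rwa [sub_add_cancel]
    have key := isingExpect_plus_faces_disorder_eq_ratio (c := a) (d := b - 1) (dualBeta β) hPsub'
    rw [sub_add_cancel] at key
    rw [key, exp_neg_two_mul_dualBeta hβ]

/-! ### BGJS (A.10), closed → open: translation to the faces and the dual path -/

section Closed

variable {c d : Site 2}

/-- Products of bond variables are spin products of the odd-degree sites: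
`∏_{b ∈ F} σ_b = σ_{∂F}` for `F ⊆ ℰ_Λ`. [folklore] -/
theorem prod_bE_eq_spinProduct_oddSet {Λ : Finset (Site 2)} {F : Finset AEdge} (hF : F ⊆ anch Λ)
    (σ : SpinConfig (Site 2)) : ∏ ε ∈ F, bE ε σ = spinProduct (oddSet Λ F) σ := by
  classical
  set τ : ↥Λ → ℤˣ := fun z => σ z with hτ
  have hg : glue Λ τ (.fixed σ) = σ := by
    funext z
    by_cases hz : z ∈ Λ
    · rw [glue_apply_of_mem _ _ _ hz]
    · rw [glue_apply_of_notMem _ _ _ hz]; rfl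
  have hsub : oddSet Λ F ⊆ Λ := Finset.filter_subset _ _
  rw [← hg, prod_bE_glue_eq hF τ (.fixed σ), spinProduct_glue_of_subset hsub τ (.fixed σ),
    ← prod_spinAt_pow_indicator]
  refine Finset.prod_congr rfl fun z _ => ?_
  have hiff : z ∈ inVol Λ (oddSet Λ F) ↔ Odd (adeg F z) := by
    simp [inVol, mem_oddSet]
  rcases spinAt_eq_one_or_eq_neg_one z τ with h | h
  · rw [h, one_pow, one_pow]
  · rw [h]
    by_cases hodd : Odd (adeg F z)
    · rw [hodd.neg_one_pow, if_pos (hiff.2 hodd), pow_one]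
    · rw [(Nat.not_odd_iff_even.1 hodd).neg_one_pow, if_neg (fun h' => hodd (hiff.1 h')), pow_zero]

/-- Shifting an anchored bond. [folklore] -/
def bshift (ε : AEdge) (v : Site 2) : AEdge := (ε.1 + v, ε.2)

/-- First endpoint of a shifted bond. [folklore] -/
@[simp] theorem bshift_fst (ε : AEdge) (v : Site 2) : (bshift ε v).1 = ε.1 + v := rfl
/-- Direction of a shifted bond. [folklore] -/
@[simp] theorem bshift_snd (ε : AEdge) (v : Site 2) : (bshift ε v).2 = ε.2 := rfl
/-- Second endpoint of a shifted bond. [folklore] -/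
theorem bshift_tip (ε : AEdge) (v : Site 2) : (bshift ε v).tip = ε.tip + v := by
  simp only [tip, bshift_fst, bshift_snd]; abel

/-- The bond of a shifted anchored bond is the shifted bond. [folklore] -/
theorem toSym2_bshift (ε : AEdge) (v : Site 2) : toSym2 (bshift ε v) = Sym2.map (· + v) (toSym2 ε) := by
  rw [toSym2, toSym2, Sym2.map_mk, bshift_tip]; rfl

/-- **The crossing bond is the uncrossing of the shifted bond**: `cross b = uncross (b − (1,1))`
(the dual of the dual lattice is the lattice shifted by `(1,1)` in the face labelling). [folklore] -/
theorem uncross_bshift_neg_one (ε : AEdge) : uncross (bshift ε (-1)) = cross ε := by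
  obtain ⟨u, i⟩ := ε
  have h := vec_add_vec_rev i
  simp only [uncross, cross, bshift, tip]
  refine Prod.ext ?_ rfl
  simp only
  rw [← h]; abel

/-- `cross = (uncross ·) − (1,1)` bondwise. [folklore] -/
theorem cross_eq_bshift_uncross (δ : AEdge) : cross δ = bshift (uncross δ) (-1) := by
  have h := uncross_bshift_neg_one (uncross δ)
  rw [cross_uncross] at h
  nth_rewrite 1 [← h]
  rw [cross_uncross]

/-- Shifting bonds and volumes together. [folklore] -/
theorem bshift_mem_anch_iff {Λ : Finset (Site 2)} (ε : AEdge) (v : Site 2) :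
    bshift ε v ∈ anch (Λ.map (Site.shift v).toEmbedding) ↔ ε ∈ anch Λ := by
  rw [mem_anch, mem_anch, mem_map_shift_iff', mem_map_shift_iff', bshift_fst, bshift_tip,
    add_sub_cancel_right, add_sub_cancel_right]

/-- Rectangles translate: `[c, d] + v = [c + v, d + v]`. [folklore] -/
theorem Icc_map_shift (c' d' v : Site 2) :
    (Finset.Icc c' d').map (Site.shift v).toEmbedding = Finset.Icc (c' + v) (d' + v) := by
  ext y
  rw [mem_map_shift_iff', mem_Icc_site, mem_Icc_site]
  simp only [Pi.sub_apply, Pi.add_apply]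
  omega

/-- The lattice translation as a graph homomorphism of `ℤ²`. [folklore] -/
def shiftHom (v : Site 2) : zdGraph 2 →g zdGraph 2 :=
  ⟨fun x => x + v, fun {x y} h => (zdGraph_adj_shift_iff v x y).2 h⟩

/-- The translation homomorphism acts by `x ↦ x + v`. [folklore] -/
@[simp] theorem shiftHom_apply (v x : Site 2) : shiftHom v x = x + v := rfl

/-- Translations are injective. [folklore] -/
theorem shiftHom_injective (v : Site 2) : Function.Injective (shiftHom v) := fun x y h => by
  simpa using h

/-- **Crossing bonds of bonds of `R` are bonds of the rectangle of faces touching `R`.** [folklore] -/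
theorem cross_mem_anch_of_mem_anch {a b : Site 2} {ε : AEdge} (hε : ε ∈ anch (Finset.Icc a b)) :
    cross ε ∈ anch (Finset.Icc (a - 1) b) := by
  rw [mem_anch, mem_Icc_site, mem_Icc_site] at hε
  rw [mem_anch, cross_tip, cross_fst, mem_Icc_site, mem_Icc_site]
  simp only [Pi.sub_apply, Pi.one_apply, tip_apply] at hε ⊢
  have h0 := vec_apply_bounds ε.2.rev 0
  have h1 := vec_apply_bounds ε.2.rev 1
  omega

/-- **Low-temperature representation of the closed two-point function of faces** (BGJS (A.4) with a
dual path): for faces `x' ≠ y'` of `Q` joined by a path of faces `Π ⊆ ℰ_Q` (`∂Π = {x', y'}`),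
`⟨σ_{x'}σ_{y'}⟩⁺_{Q;β',0} = ∑_{∂F=∅} v^{|F|} (−1)^{|F ∩ Π×|} / ∑_{∂F=∅} v^{|F|}`, `v = e^{-2β'}`, where
`Π× ⊆ ℰ_S` are the bonds of `S` crossed by the dual bonds of `Π`: the spins telescope along `Π` and
each factor is `−1` exactly on the separating bonds. [cite: BenettinGallavottiJonaLasinioStella1973, Appendix a), eq. (A.4)] -/
theorem isingCorr_plus_faces_pair_eq_ratio (β' : ℝ) {x' y' : Site 2} {Pth : Finset AEdge}
    (hPth : Pth ⊆ anch (Finset.Icc c d)) (hodd : oddSet (Finset.Icc c d) Pth = {x', y'}) :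
    isingCorr (zdGraph 2) (Finset.Icc c d) β' 0 .plus {x', y'} =
      (∑ F ∈ bondSets (Finset.Icc c (d + 1)) ∅,
          Real.exp (-2 * β') ^ #F * (-1) ^ #(F ∩ Pth.image uncross)) /
        ∑ F ∈ bondSets (Finset.Icc c (d + 1)) ∅, Real.exp (-2 * β') ^ #F := by
  classical
  set v : ℝ := Real.exp (-2 * β') with hv
  set C : ℝ := Real.exp (β' * (#(anch (Finset.Icc c (d + 1))) -
    #((anch (Finset.Icc c (d + 1))).filter fun ε => cross ε ∉ anchT (Finset.Icc c d)))) with hC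
  have hC0 : 0 < C := Real.exp_pos _
  rw [isingCorr, isingExpect_eq_sum_div (zdGraph 2) _ 0 .plus β' (measurable_spinProduct _),
    isingPartitionFunction]
  -- the observable in terms of the separating set
  have hPT : ∀ δ ∈ Pth, uncross δ ∈ anch (Finset.Icc c (d + 1)) := fun δ hδ =>
    uncross_mem_anch_of_mem_anchT (by
      have h := mem_anch.1 (hPth hδ)
      exact mem_anchT.2 (Or.inl h.1))
  have hobs : ∀ τ : ↥(Finset.Icc c d) → ℤˣ, spinProduct {x', y'} (glue (Finset.Icc c d) τ .plus) =
      (-1) ^ #(sepSet c d (glue (Finset.Icc c d) τ .plus) ∩ Pth.image uncross) := by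
    intro τ
    set ρ := glue (Finset.Icc c d) τ .plus with hρ
    rw [← hodd, ← prod_bE_eq_spinProduct_oddSet hPth ρ]
    have h1 : ∀ δ ∈ Pth, bE δ ρ = if uncross δ ∈ sepSet c d ρ then -1 else 1 := by
      intro δ hδ
      have hmem : uncross δ ∈ sepSet c d ρ ↔ bE δ ρ = -1 := by
        rw [mem_sepSet, cross_uncross]
        exact ⟨fun h => h.2, fun h => ⟨hPT δ hδ, h⟩⟩
      by_cases h : uncross δ ∈ sepSet c d ρ
      · rw [if_pos h]; exact hmem.1 h
      · rw [if_neg h]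
        rcases bE_eq_one_or δ ρ with h' | h'
        · exact h'
        · exact absurd (hmem.2 h') h
    rw [Finset.prod_congr rfl h1, Finset.prod_ite, Finset.prod_const, Finset.prod_const, one_pow,
      mul_one]
    congr 1
    rw [← Finset.card_image_of_injOn (f := uncross) (fun δ _ δ' _ h => by
        rw [← cross_uncross δ, h, cross_uncross])]
    congr 1
    ext ε
    simp only [Finset.mem_image, Finset.mem_filter, Finset.mem_inter]
    constructor
    · rintro ⟨δ, ⟨hδ, hsep⟩, rfl⟩
      exact ⟨hsep, δ, hδ, rfl⟩
    · rintro ⟨hsep, δ, hδ, rfl⟩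
      exact ⟨δ, ⟨hδ, hsep⟩, rfl⟩
  have hnum : ∀ τ : ↥(Finset.Icc c d) → ℤˣ,
      isingWeight (zdGraph 2) (Finset.Icc c d) β' 0 .plus τ * spinProduct {x', y'} (glue (Finset.Icc c d) τ .plus) =
        C * (v ^ #(sepSet c d (glue (Finset.Icc c d) τ .plus)) *
          (-1) ^ #(sepSet c d (glue (Finset.Icc c d) τ .plus) ∩ Pth.image uncross)) := fun τ => by
    rw [hobs τ, isingWeight_plus_faces_eq, ← hC, ← hv, mul_assoc]
  have hden : ∀ τ : ↥(Finset.Icc c d) → ℤˣ, isingWeight (zdGraph 2) (Finset.Icc c d) β' 0 .plus τ =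
      C * v ^ #(sepSet c d (glue (Finset.Icc c d) τ .plus)) := fun τ => by
    rw [isingWeight_plus_faces_eq, ← hC, ← hv]
  rw [Finset.sum_congr rfl fun τ _ => hnum τ, Finset.sum_congr rfl fun τ _ => hden τ]
  simp only [← Finset.mul_sum]
  rw [sum_cfg_eq_sum_bondSets (fun D => v ^ #D * (-1) ^ #(D ∩ Pth.image uncross)),
    sum_cfg_eq_sum_bondSets (fun D => v ^ #D), mul_div_mul_left _ _ hC0.ne']

/-- `bshift · v` is injective. [folklore] -/
theorem bshift_injective (v : Site 2) : Function.Injective fun ε : AEdge => bshift ε v := by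
  rintro ⟨u, i⟩ ⟨w, j⟩ h
  simp only [bshift, Prod.mk.injEq, add_left_inj] at h
  exact Prod.ext h.1 h.2

/-- Degrees are translation covariant. [folklore] -/
theorem adeg_image_bshift (F : Finset AEdge) (v w : Site 2) :
    adeg (F.image fun ε => bshift ε v) w = adeg F (w - v) := by
  classical
  rw [adeg, adeg, Finset.filter_image, Finset.card_image_of_injective _ (bshift_injective v)]
  congr 1
  ext ε
  simp only [Finset.mem_filter, bshift_fst, bshift_tip]
  constructor
  · rintro ⟨h1, h2 | h2⟩
    · exact ⟨h1, Or.inl (by rw [h2, add_sub_cancel_right])⟩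
    · exact ⟨h1, Or.inr (by rw [h2, add_sub_cancel_right])⟩
  · rintro ⟨h1, h2 | h2⟩
    · exact ⟨h1, Or.inl (by rw [← h2, sub_add_cancel])⟩
    · exact ⟨h1, Or.inr (by rw [← h2, sub_add_cancel])⟩

/-- Odd-degree sets are translation covariant. [folklore] -/
theorem oddSet_image_bshift (Λ : Finset (Site 2)) (F : Finset AEdge) (v : Site 2) :
    oddSet (Λ.map (Site.shift v).toEmbedding) (F.image fun ε => bshift ε v) =
      (oddSet Λ F).map (Site.shift v).toEmbedding := by
  ext w
  rw [mem_oddSet, mem_map_shift_iff', mem_map_shift_iff', mem_oddSet, adeg_image_bshift]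

/-- **The free dual expectation of the disorder observable as a signed polygon ratio** (BGJS App.
c): on the faces touching `R = [a,b]`, for a path `Γ` inside `R`,
`⟨∏_{b∈Γ}(cosh 2β' − σ_{b*} sinh 2β')⟩^∅_{[a−(1,1), b];β',0} = ∑_{∂F=∅} t^{|F|}(−1)^{|F ∩ Γ×|} / ∑_{∂F=∅} t^{|F|}`,
`t = tanh β'`, `Γ× = cross(Γ)`). [cite: BenettinGallavottiJonaLasinioStella1973, Appendix c), eq. (A.10)] -/
theorem isingExpect_free_touching_disorder_eq_ratio (β' : ℝ) {a b x y : Site 2}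
    (p : (zdGraph 2).Walk x y) (hp : p.IsPath) (hsupp : ∀ z ∈ p.support, z ∈ Finset.Icc a b) :
    isingExpect (zdGraph 2) (Finset.Icc (a - 1) b) β' 0 .free (kwDisorder β' p.edges) =
      (∑ F ∈ bondSets (Finset.Icc (a - 1) b) ∅,
          Real.tanh β' ^ #F * (-1) ^ #(F ∩ (pathSet (Finset.Icc a b) p).image cross)) /
        ∑ F ∈ bondSets (Finset.Icc (a - 1) b) ∅, Real.tanh β' ^ #F := by
  classical
  set P' := (pathSet (Finset.Icc a b) p).image cross with hP'def
  have hP' : P' ⊆ anch (Finset.Icc (a - 1) b) := by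
    intro ε' hε'
    rw [hP'def, Finset.mem_image] at hε'
    obtain ⟨ε, hε, rfl⟩ := hε'
    exact cross_mem_anch_of_mem_anch (pathSet_subset _ p hε)
  have hobs : kwDisorder β' p.edges = fun σ => ∏ ε' ∈ P', (Real.cosh (2 * β') - Real.sinh (2 * β') * bE ε' σ) := by
    funext σ
    rw [kwDisorder_eq_prod_pathSet p hp hsupp, hP'def,
      Finset.prod_image fun ε _ ε' _ h => cross_injective h]
  rw [hobs, isingExpect_free_disorder_eq_ratio _ β' hP']
  congr 1
  refine Finset.sum_congr rfl fun F _ => ?_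
  rw [Finset.prod_ite, Finset.prod_const, Finset.prod_const, Finset.filter_mem_eq_inter, neg_pow]
  have hcard : #(F ∩ P') + #(F.filter fun ε => ε ∉ P') = #F := by
    rw [← Finset.filter_mem_eq_inter]
    exact Finset.card_filter_add_card_filter_not (s := F) (fun ε => ε ∈ P')
  calc (-1) ^ #(F ∩ P') * Real.tanh β' ^ #(F ∩ P') * Real.tanh β' ^ #(F.filter fun ε => ε ∉ P')
      = (-1) ^ #(F ∩ P') * Real.tanh β' ^ (#(F ∩ P') + #(F.filter fun ε => ε ∉ P')) := by rw [pow_add]; ring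
    _ = Real.tanh β' ^ #F * (-1) ^ #(F ∩ P') := by rw [hcard, mul_comm]

/-- **Discharge of `kw_plus_free_finite`** (BGJS, CMP 30 (1973), Appendix, eq. (A.10), closed →
open): for `β > 0`, a rectangle `R = [a,b]`, `x, y ∈ R` and a lattice path `Γ` from `x` to `y`
inside `R`, `⟨σ_xσ_y⟩⁺_{R;β,0} = ⟨∏_{b∈Γ}(cosh 2β* − σ_{b*} sinh 2β*)⟩^∅_{[a−(1,1),b];β*,0}`. Proof: both
sides equal `∑_{∂F=∅} v^{|F|}(−1)^{|F ∩ Γ×|} / ∑_{∂F=∅} v^{|F|}` over the closed polygons `F` of the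
rectangle of faces `[a−(1,1), b]`, `v = e^{-2β} = tanh β*` — the left by translating the closed
rectangle of sites to the rectangle of faces `[a−(1,1), b−(1,1)]` and the low-temperature
expansion with the spins telescoped along `Γ − (1,1)`, the right by the high-temperature
expansion with the sign of `tanh β*` flipped on `Γ×`. [cite: BenettinGallavottiJonaLasinioStella1973, Appendix, eq. (A.10)] -/
theorem kw_plus_free_finite_holds : kw_plus_free_finite := by
  intro β hβ a b x y p hp hsupp
  classical
  by_cases hxy : x = y
  · subst hxy
    have hnil : p = SimpleGraph.Walk.nil :=
      SimpleGraph.Walk.eq_nil_iff_nil.2 (SimpleGraph.Walk.isPath_iff_nil.1 hp)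
    subst hnil
    have h1 : kwDisorder (dualBeta β) (SimpleGraph.Walk.nil : (zdGraph 2).Walk x x).edges =
        fun _ => (1 : ℝ) := funext fun σ => by simp
    rw [isingTwoPoint_self, h1, isingExpect_const]
  · set R := Finset.Icc a b with hRdef
    -- translate the closed rectangle of sites onto the rectangle of faces `[a − 1, b − 1]`
    have hR : (Finset.Icc (a - 1) (b - 1)).map (Site.shift (1 : Site 2)).toEmbedding = R := by
      rw [Icc_map_shift, sub_add_cancel, sub_add_cancel]
    have hxy' : x - 1 ≠ y - 1 := fun h => hxy (sub_left_injective h)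
    have hLHS : isingTwoPoint (zdGraph 2) R β 0 .plus x y =
        isingCorr (zdGraph 2) (Finset.Icc (a - 1) (b - 1)) β 0 .plus {x - 1, y - 1} := by
      rw [isingTwoPoint, ← hR, isingExpect_plus_shift _ _ _ _ (measurable_spinPair x y), isingCorr,
        ← spinPair_eq_spinProduct hxy']
      congr 1
    -- the shifted path set on the faces
    set Pth : Finset AEdge := (pathSet R p).image fun ε => bshift ε (-1) with hPth
    have hPsub : Pth ⊆ anch (Finset.Icc (a - 1) (b - 1)) := by
      intro ε' hε'
      rw [hPth, Finset.mem_image] at hε'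
      obtain ⟨ε, hε, rfl⟩ := hε'
      have h1 : Finset.Icc (a - 1) (b - 1) = R.map (Site.shift (-1 : Site 2)).toEmbedding := by
        rw [hRdef, Icc_map_shift]; congr 1
      rw [h1, bshift_mem_anch_iff]
      exact pathSet_subset R p hε
    have hodd : oddSet (Finset.Icc (a - 1) (b - 1)) Pth = {x - 1, y - 1} := by
      have h1 : Finset.Icc (a - 1) (b - 1) = R.map (Site.shift (-1 : Site 2)).toEmbedding := by
        rw [hRdef, Icc_map_shift]; congr 1
      rw [h1, hPth, oddSet_image_bshift, oddSet_pathSet p hp hsupp hxy, Finset.map_insert,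
        Finset.map_singleton]
      simp [sub_eq_add_neg]
    have himg : Pth.image uncross = (pathSet R p).image cross := by
      rw [hPth, Finset.image_image]
      congr 1
      funext ε
      exact uncross_bshift_neg_one ε
    rw [hLHS, isingCorr_plus_faces_pair_eq_ratio (c := a - 1) (d := b - 1) β hPsub hodd, himg,
      sub_add_cancel, isingExpect_free_touching_disorder_eq_ratio (dualBeta β) p hp hsupp,
      tanh_dualBeta hβ]

end Closed

/-! ### The thermodynamic limit: BGJS (2.3)–(2.4) -/

section Limits

/-- Plus correlations along volumes sandwiched between consecutive boxes converge to the plus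
state (antitonicity in the volume, Friedli–Velenik 2017, Lemma 3.22 / Exercise 3.12). [cite: FriedliVelenik2017, Exercise 3.12, p. 112] -/
theorem tendsto_isingCorr_plus_of_sandwich {β : ℝ} (hβ : 0 ≤ β) (V : ℕ → Finset (Site 2))
    (hV1 : ∀ L, 1 ≤ L → box 2 (L - 1) ⊆ V L) (hV2 : ∀ L, V L ⊆ box 2 L) (A : Finset (Site 2)) :
    Tendsto (fun L => isingCorr (zdGraph 2) (V L) β 0 .plus A) atTop (𝓝 (plusCorr 2 β 0 A)) := by
  obtain ⟨L₀, hL₀⟩ := exists_forall_subset_box 2 A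
  have hlim : Tendsto (fun L : ℕ => isingCorr (zdGraph 2) (box 2 L) β 0 .plus A) atTop
      (𝓝 (plusCorr 2 β 0 A)) := hasBoxLimit_isingCorr_plus_holds (d := 2) hβ le_rfl A
  have hlim' : Tendsto (fun L : ℕ => isingCorr (zdGraph 2) (box 2 (L - 1)) β 0 .plus A) atTop
      (𝓝 (plusCorr 2 β 0 A)) := hlim.comp (tendsto_sub_atTop_nat 1)
  refine tendsto_of_tendsto_of_tendsto_of_le_of_le' hlim hlim' ?_ ?_
  · filter_upwards [eventually_ge_atTop (L₀ + 1)] with L hL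
    exact isingCorr_plus_le_of_subset (zdGraph 2) hβ le_rfl
      ((hL₀ (L - 1) (by omega)).trans (hV1 L (by omega))) (hV2 L)
  · filter_upwards [eventually_ge_atTop (L₀ + 1)] with L hL
    exact isingCorr_plus_le_of_subset (zdGraph 2) hβ le_rfl (hL₀ (L - 1) (by omega)) (hV1 L (by omega))

/-- Free correlations along volumes sandwiched between consecutive boxes converge to the free
state (monotonicity in the volume, Friedli–Velenik 2017, Exercise 3.12 / 3.16). [cite: FriedliVelenik2017, Exercise 3.16] -/
theorem tendsto_isingCorr_free_of_sandwich {β : ℝ} (hβ : 0 ≤ β) (V : ℕ → Finset (Site 2))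
    (hV1 : ∀ L, box 2 L ⊆ V L) (hV2 : ∀ L, V L ⊆ box 2 (L + 1)) (A : Finset (Site 2)) :
    Tendsto (fun L => isingCorr (zdGraph 2) (V L) β 0 .free A) atTop (𝓝 (freeCorr 2 β 0 A)) := by
  obtain ⟨L₀, hL₀⟩ := exists_forall_subset_box 2 A
  have hlim : Tendsto (fun L : ℕ => isingCorr (zdGraph 2) (box 2 L) β 0 .free A) atTop
      (𝓝 (freeCorr 2 β 0 A)) := hasBoxLimit_isingCorr_free_holds (d := 2) hβ le_rfl A
  have hlim' : Tendsto (fun L : ℕ => isingCorr (zdGraph 2) (box 2 (L + 1)) β 0 .free A) atTop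
      (𝓝 (freeCorr 2 β 0 A)) := hlim.comp (tendsto_add_atTop_nat 1)
  refine tendsto_of_tendsto_of_tendsto_of_le_of_le' hlim hlim' ?_ ?_
  · filter_upwards [eventually_ge_atTop L₀] with L hL
    exact isingCorr_free_le_of_subset (zdGraph 2) hβ le_rfl (hL₀ L hL) (hV1 L)
  · filter_upwards [eventually_ge_atTop L₀] with L hL
    exact isingCorr_free_le_of_subset (zdGraph 2) hβ le_rfl ((hL₀ L hL).trans (hV1 L)) (hV2 L)

/-- Finite-volume expectations of a spin polynomial are the corresponding combinations of
correlations. [folklore] -/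
theorem isingExpect_spinPolynomial (Λ : Finset (Site 2)) (β : ℝ) (bc : BoundaryCondition (Site 2))
    (S : Finset (Finset (Site 2))) (c : Finset (Site 2) → ℝ) :
    isingExpect (zdGraph 2) Λ β 0 bc (fun σ => ∑ A ∈ S, c A * spinProduct A σ) =
      ∑ A ∈ S, c A * isingCorr (zdGraph 2) Λ β 0 bc A := by
  rw [isingExpect_finset_sum' (zdGraph 2) Λ 0 bc β S _ fun A => (measurable_spinProduct A).const_mul (c A)]
  refine Finset.sum_congr rfl fun A _ => ?_
  rw [isingExpect_const_mul' (zdGraph 2) Λ 0 bc β _ (measurable_spinProduct A)]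
  rfl

/-- Plus expectations of spin polynomials along sandwiched volumes converge to the plus state. [cite: FriedliVelenik2017, Thm. 3.17] -/
theorem tendsto_isingExpect_plus_of_sandwich {β : ℝ} (hβ : 0 ≤ β) (V : ℕ → Finset (Site 2))
    (hV1 : ∀ L, 1 ≤ L → box 2 (L - 1) ⊆ V L) (hV2 : ∀ L, V L ⊆ box 2 L)
    {f : SpinConfig (Site 2) → ℝ} (hf : IsSpinPolynomial f) :
    Tendsto (fun L => isingExpect (zdGraph 2) (V L) β 0 .plus f) atTop (𝓝 (plusExpect 2 β 0 f)) := by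
  obtain ⟨S, c, rfl⟩ := hf
  rw [plusExpect_spinPolynomial hβ]
  simp only [isingExpect_spinPolynomial]
  exact tendsto_finsetSum _ fun A _ => (tendsto_isingCorr_plus_of_sandwich hβ V hV1 hV2 A).const_mul _

/-- Free expectations of spin polynomials along sandwiched volumes converge to the free state. [cite: FriedliVelenik2017, Exercise 3.16] -/
theorem tendsto_isingExpect_free_of_sandwich {β : ℝ} (hβ : 0 ≤ β) (V : ℕ → Finset (Site 2))
    (hV1 : ∀ L, box 2 L ⊆ V L) (hV2 : ∀ L, V L ⊆ box 2 (L + 1))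
    {f : SpinConfig (Site 2) → ℝ} (hf : IsSpinPolynomial f) :
    Tendsto (fun L => isingExpect (zdGraph 2) (V L) β 0 .free f) atTop (𝓝 (freeExpect 2 β 0 f)) := by
  obtain ⟨S, c, rfl⟩ := hf
  rw [freeExpect_spinPolynomial hβ]
  simp only [isingExpect_spinPolynomial]
  exact tendsto_finsetSum _ fun A _ => (tendsto_isingCorr_free_of_sandwich hβ V hV1 hV2 A).const_mul _

/-- The support of a walk eventually lies in the boxes. [folklore] -/
theorem eventually_support_subset_box {x y : Site 2} (p : (zdGraph 2).Walk x y) :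
    ∃ L₀ : ℕ, ∀ L, L₀ ≤ L → ∀ z ∈ p.support, z ∈ box 2 L := by
  classical
  obtain ⟨L₀, hL₀⟩ := exists_forall_subset_box 2 p.support.toFinset
  exact ⟨L₀, fun L hL z hz => hL₀ L hL (List.mem_toFinset.2 hz)⟩

/-- **Discharge of `kw_free_plus` (BGJS eq. (2.3), thermodynamic limit)**: for `β > 0`, every `x`
and every lattice path `Γ` from `0` to `x`, `⟨σ₀σ_x⟩^∅_{β,0} = ⟨∏_{b∈Γ}(cosh 2β* − σ_{b*} sinh 2β*)⟩⁺_{β*,0}`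
(BGJS: (A.10) "holds also in the thermodynamic limit"): apply (A.10) in the boxes `Λ(L) = [−L, L]²`,
whose faces `[−L, L−1]²` are sandwiched between `Λ(L−1)` and `Λ(L)`; the left sides converge to
the free state and the right sides, the disorder observable being a spin polynomial, to the plus
state. [cite: BenettinGallavottiJonaLasinioStella1973, eq. (2.3)] -/
theorem kw_free_plus_holds : kw_free_plus := by
  intro β hβ x p hp
  classical
  have hβ' : 0 ≤ dualBeta β := (dualBeta_pos hβ).le
  obtain ⟨L₀, hL₀⟩ := eventually_support_subset_box p
  set V : ℕ → Finset (Site 2) := fun L => Finset.Icc (-(L : Site 2)) ((L : Site 2) - 1) with hV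
  have hfin : ∀ L, L₀ ≤ L → isingTwoPoint (zdGraph 2) (box 2 L) β 0 .free 0 x =
      isingExpect (zdGraph 2) (V L) (dualBeta β) 0 .plus (kwDisorder (dualBeta β) p.edges) := by
    intro L hL
    rw [box_eq_Icc]
    refine kw_free_plus_finite_holds hβ (-(L : Site 2)) L 0 x p hp fun z hz => ?_
    rw [← box_eq_Icc]; exact hL₀ L hL z hz
  have hLHS : Tendsto (fun L : ℕ => isingTwoPoint (zdGraph 2) (box 2 L) β 0 .free 0 x) atTop
      (𝓝 (twoPointFree 2 β x)) :=
    tendsto_isingTwoPoint_free hasBoxLimit_isingCorr_free_holds hβ.le x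
  have hV1 : ∀ L, 1 ≤ L → box 2 (L - 1) ⊆ V L := by
    intro L hL z hz
    rw [mem_box] at hz
    rw [hV, mem_Icc_site]
    have h0 := hz 0
    have h1 := hz 1
    simp only [Pi.neg_apply, Pi.natCast_apply, Pi.sub_apply, Pi.one_apply]
    push_cast [Nat.cast_sub hL] at h0 h1
    omega
  have hV2 : ∀ L, V L ⊆ box 2 L := by
    intro L z hz
    rw [hV, mem_Icc_site] at hz
    simp only [Pi.neg_apply, Pi.natCast_apply, Pi.sub_apply, Pi.one_apply] at hz
    rw [mem_box, Fin.forall_fin_two]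
    omega
  have hRHS : Tendsto (fun L : ℕ => isingExpect (zdGraph 2) (V L) (dualBeta β) 0 .plus
      (kwDisorder (dualBeta β) p.edges)) atTop (𝓝 (plusExpect 2 (dualBeta β) 0 (kwDisorder (dualBeta β) p.edges))) :=
    tendsto_isingExpect_plus_of_sandwich hβ' V hV1 hV2 (kwDisorder_isSpinPolynomial _ _)
  have hEq : (fun L : ℕ => isingTwoPoint (zdGraph 2) (box 2 L) β 0 .free 0 x) =ᶠ[atTop]
      fun L => isingExpect (zdGraph 2) (V L) (dualBeta β) 0 .plus (kwDisorder (dualBeta β) p.edges) := by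
    filter_upwards [eventually_ge_atTop L₀] with L hL
    exact hfin L hL
  exact tendsto_nhds_unique (hLHS.congr' hEq) hRHS

/-- **Discharge of `kw_plus_free` (BGJS eq. (2.4), thermodynamic limit)**: for `β > 0`, every `x`
and every lattice path `Γ` from `0` to `x`, `⟨σ₀σ_x⟩⁺_{β,0} = ⟨∏_{b∈Γ}(cosh 2β* − σ_{b*} sinh 2β*)⟩^∅_{β*,0}`:
(A.10) in the boxes `[−L, L]²`, whose touching faces `[−L−1, L]²` are sandwiched between `Λ(L)`
and `Λ(L+1)`. [cite: BenettinGallavottiJonaLasinioStella1973, eq. (2.4)] -/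
theorem kw_plus_free_holds : kw_plus_free := by
  intro β hβ x p hp
  classical
  have hβ' : 0 ≤ dualBeta β := (dualBeta_pos hβ).le
  obtain ⟨L₀, hL₀⟩ := eventually_support_subset_box p
  set V : ℕ → Finset (Site 2) := fun L => Finset.Icc (-(L : Site 2) - 1) (L : Site 2) with hV
  have hfin : ∀ L, L₀ ≤ L → isingTwoPoint (zdGraph 2) (box 2 L) β 0 .plus 0 x =
      isingExpect (zdGraph 2) (V L) (dualBeta β) 0 .free (kwDisorder (dualBeta β) p.edges) := by
    intro L hL
    rw [box_eq_Icc]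
    refine kw_plus_free_finite_holds hβ (-(L : Site 2)) L 0 x p hp fun z hz => ?_
    rw [← box_eq_Icc]; exact hL₀ L hL z hz
  have hLHS : Tendsto (fun L : ℕ => isingTwoPoint (zdGraph 2) (box 2 L) β 0 .plus 0 x) atTop
      (𝓝 (twoPointPlus 2 β x)) :=
    tendsto_isingTwoPoint_plus hasBoxLimit_isingCorr_plus_holds hβ.le x
  have hV1 : ∀ L, box 2 L ⊆ V L := by
    intro L z hz
    rw [mem_box] at hz
    rw [hV, mem_Icc_site]
    have h0 := hz 0
    have h1 := hz 1
    simp only [Pi.neg_apply, Pi.natCast_apply, Pi.sub_apply, Pi.one_apply]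
    omega
  have hV2 : ∀ L, V L ⊆ box 2 (L + 1) := by
    intro L z hz
    rw [hV, mem_Icc_site] at hz
    simp only [Pi.neg_apply, Pi.natCast_apply, Pi.sub_apply, Pi.one_apply] at hz
    rw [mem_box, Fin.forall_fin_two]
    push_cast
    omega
  have hRHS : Tendsto (fun L : ℕ => isingExpect (zdGraph 2) (V L) (dualBeta β) 0 .free
      (kwDisorder (dualBeta β) p.edges)) atTop (𝓝 (freeExpect 2 (dualBeta β) 0 (kwDisorder (dualBeta β) p.edges))) :=
    tendsto_isingExpect_free_of_sandwich hβ' V hV1 hV2 (kwDisorder_isSpinPolynomial _ _)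
  have hEq : (fun L : ℕ => isingTwoPoint (zdGraph 2) (box 2 L) β 0 .plus 0 x) =ᶠ[atTop]
      fun L => isingExpect (zdGraph 2) (V L) (dualBeta β) 0 .free (kwDisorder (dualBeta β) p.edges) := by
    filter_upwards [eventually_ge_atTop L₀] with L hL
    exact hfin L hL
  exact tendsto_nhds_unique (hLHS.congr' hEq) hRHS

end Limits

end Literature.Probability.LatticeModels
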